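import Literature.NumberTheory.Sieve.PolyaVinogradovTwoOverPi
import Literature.Analysis.Fourier.AbsSinFourierSeries
import Mathlib.MeasureTheory.Integral.IntervalIntegral.IntegrationByParts
import Mathlib.Analysis.SpecialFunctions.Trigonometric.Bounds
import Mathlib.Analysis.Real.Pi.Bounds
import Mathlib.Analysis.Complex.ExponentialBounds
import Mathlib.NumberTheory.Harmonic.Bounds
import Mathlib.Algebra.BigOperators.Module
import HarnessLib

/-!
# The Pólya–Vinogradov inequality for odd primitive characters with Landau's constant `1/(2π)`

Topic `Literature/NumberTheory/Sieve` (namespace `Literature.NumberTheory.Sieve.LargeSieve`, as the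
tree's `polyaVinogradov`, `polyaVinogradov_two_div_pi`). Everything here is PROVED: the file declares
five auxiliary real-valued functions (`Sawtooth.sinSum`, `cosSum`, `cosPartial`, `sawZ`, `tailB`) with
bodies and theorems only — no named fact, no hypothesis taken as a parameter.

**Main result** (`polyaVinogradov_odd`, `polyaVinogradov_odd_Icc`, `polyaVinogradov_odd_int`): for a
primitive Dirichlet character `χ mod q` with `χ(−1) = −1` and every interval of consecutive integers,

  `|Σ_n χ(n)| ≤ (1/(2π)) √q log q + (1/π) √q log log q + (5/2) √q + 1`.

A parity-free by-product of the same machinery (last section): for EVERY primitive `χ mod q`, `q ≥ 2`,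
`|Σ_n χ(n)| ≤ (1/π) √q log q + (2/π) √q log log q + 2 √q + 1` (`polyaVinogradov_one_div_pi`, `_Icc`,
`_int`) — Landau's constant `1/π` of [Pomerance2011] §1 (2), half the tree's `polyaVinogradov_two_div_pi`.
The EVEN case with the Bateman–Pomerance constant (last section but one): for `χ` primitive and even mod
`q ≥ 2`, `|Σ_n χ(n)| ≤ (2/π²) √q log q + (4/π²) √q log log q + 3 √q + 1` (`polyaVinogradov_even`,
`_Icc`, `_int`; [Pomerance2011] Theorem 1, even case, has `(3/2)√q` after a finite check), using the
Fourier series of `|sin|` from the tree's `Literature.Analysis.Fourier.hasSum_abs_sin_nat` in place of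
[Pomerance2011] Lemma 3.

This is Landau's 1918 leading constant `1/(2π)` for odd characters (E. Landau, *Abschätzungen von
Charaktersummen, Einheiten und Klassenzahlen*, Gött. Nachr. 1918, 79–97, as recapitulated in
[Pomerance2011] §1 (2) and the lines after it), in the numerically explicit form of Pomerance's
Theorem 1, odd case: `S(χ) ≤ (1/(2π)) q^{1/2} log q + (1/π) q^{1/2} log log q + q^{1/2}`
([Pomerance2011] Theorem 1 and §4 (11)). Pomerance absorbs the lower-order terms into `q^{1/2}` for
`q ≥ 45` and checks `q < 45` against the Bober–Goldmakher tables; the kernel proof here keeps explicit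
secondary terms `(5/2)√q + 1` valid for every `q` instead (no finite check), and uses the cruder lower
bound `C_n(x) ≥ −(π + 1)` (Abel summation) for the cosine sums `C_n(x) = Σ_{m≤n} cos(mx)/m` in place
of Young's `C_n(x) ≥ −1` / [Pomerance2011] Lemma 2 (`> −log 2 − 2/n`), which costs about `1.1 √q`.

**The argument** is Landau's, in the finite form of [Pomerance2011] §§2, 4, followed step by step:

* §2, proof of Lemma 4: the sawtooth `(π − y)/2 = Σ_{m≥1} sin(my)/m` on `(0, 2π)` has
  `|(π − y)/2 − Σ_{m≤n} sin(my)/m| ≤ 1/((n + ½) sin(y/2))` (`Sawtooth.abs_sawtooth_sub_sinSum_le`,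
  by integrating `½ + Σ_{m≤n} cos(mt) = sin((n+½)t)/(2 sin(t/2))` from `y` to `π` by parts; Pomerance
  quotes Landau's `1/((n+1) sin(x/2))` for the infinite tail `R_n`), hence over one period the tails at
  the points `2πa/q` add up to at most `(1/(n+½)) Σ_{0<a<q} csc(πa/q)` (Lemma 4, (4);
  `Sawtooth.norm_sum_char_mul_tail_le`), and Landau's cosecant sum
  `Σ_{0<a<q} csc(πa/q) ≤ (2/π) q log q + (2/5) q` is the tree's
  `Literature.Analysis.Quadrature.sum_inv_sin_le` ((4)–(5)).
* §4, first display: the indicator of an arc of `ℤ/q` with half weights at its end-points is a constant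
  plus `(1/π)(saw_q(k) − saw_q(k − L))` (`Sawtooth.sum_mul_sawZ_sub_sawZ`, the discrete sawtooth
  `Sawtooth.sawZ`); the constant term drops out since `Σ_{k mod q} χ(k) = 0`.
* §2 (7), (9)–(10) and §4 "`C_n = (iτ(χ)/π) Σ_m (χ̄(m)/m)(cos(2πMm/q) − cos(2πNm/q))`": for odd
  primitive `χ`, `Σ_{k mod q} χ(k) sin(2πm(k − w)/q) = −i τ(χ) χ̄(m) cos(2πmw/q)`
  (`Sawtooth.sum_char_shift_mul_sin`, from `Σ_k χ(k) e(mk/q) = τ(χ) χ̄(m)` for all `m`, the tree's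
  `sum_inv_mul_e_eq`), so the main term is at most `(√q/π) Σ_{m≤n} |cos mα − cos mβ|/m`
  (`|τ(χ)| = √q`, the tree's `norm_gaussSum_sq`).
* §4, display after (10): `|cos mα − cos mβ| = 2|sin(m(α+β)/2) sin(m(α−β)/2)| ≤ 1 −
  (cos m(α+β) + cos m(α−β))/2` (AM–GM where Pomerance uses Cauchy–Schwarz, same outcome), so
  `Σ_{m≤n} |cos mα − cos mβ|/m ≤ H_n − (C_n(α+β) + C_n(α−β))/2 ≤ H_n + π + 1`
  (`Sawtooth.sum_abs_cos_sub_cos_div_le`, `Sawtooth.neg_pi_add_one_le_cosSum`).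
* §4, choice of `n`: Pomerance takes `n = ⌊(4/π)√q log q⌋`; here `n = ⌊2√q log q⌋ + 1`, `H_n ≤ 1 + log n
  ≤ 1 + log 3 + ½ log q + log log q`, and `(2 + log 3 + π) + 2/π + 2/5 ≤ (5/2)π`
  (`Sawtooth.block_bound_numerics`), giving the block bound `Sawtooth.norm_sum_char_block_le` for fewer
  than `q` consecutive integers; full periods contribute nothing (`Sawtooth.sum_char_Ico_period_mul_eq_zero`).

The even case (`χ(−1) = 1`, constant `2/π²`, [Pomerance2011] §3) needs in addition the Fourier series
of `|sin θ|` (Lemma 3); it is treated in the last sections with the tree's `hasSum_abs_sin_nat`. Compare the tree's `polyaVinogradov` (`√q (1 + log q)`,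
Cojocaru–Murty), `polyaVinogradov_two_div_pi` (`(2/π)√q log q + (2/5)√q`, all primitive `χ`) and the
named fact `frolenkovSoundararajan2013_pv` (Frolenkov–Soundararajan's `2/π²` / `1/(2π)` with smaller
secondary terms; not proved in the tree and not implied by the present bound).

## References

* C. Pomerance, *Remarks on the Pólya–Vinogradov inequality*, Integers 11 (2011) 531–542: Theorem 1,
  §2 (Lemmas 2, 4, (3)–(10)), §4 (11) (held: `paper:doi-10-1515-integ-2011-039`, pp. 2–6, 8–9).
  [Pomerance2011]
* H. L. Montgomery, R. C. Vaughan, *Multiplicative Number Theory I*, CUP 2007, §9.4 (Pólya–Vinogradov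
  via Gauss sums). [MontgomeryVaughan2007]
-/

noncomputable section

open Finset Real MeasureTheory intervalIntegral

namespace Literature.NumberTheory.Sieve.LargeSieve

namespace Sawtooth

/-- The partial sum `P_n(y) = Σ_{m=1}^{n} sin(m y)/m` of the sawtooth series. [folklore] -/
def sinSum (n : ℕ) (y : ℝ) : ℝ := ∑ m ∈ range n, Real.sin ((m + 1 : ℕ) * y) / (m + 1 : ℕ)

/-- The cosine sum `C_n(x) = Σ_{m=1}^{n} cos(m x)/m`. [folklore] -/
def cosSum (n : ℕ) (x : ℝ) : ℝ := ∑ m ∈ range n, Real.cos ((m + 1 : ℕ) * x) / (m + 1 : ℕ)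

/-- The Dirichlet-kernel sum `Σ_{m=1}^{k} cos(m x)`. [folklore] -/
def cosPartial (k : ℕ) (x : ℝ) : ℝ := ∑ m ∈ range k, Real.cos ((m + 1 : ℕ) * x)

/-- **Dirichlet kernel:** `2 sin(x/2) (½ + Σ_{m=1}^{k} cos(m x)) = sin((k + ½) x)`. [folklore] -/
private theorem two_sin_half_mul_cosPartial (k : ℕ) (x : ℝ) :
    2 * Real.sin (x / 2) * (1 / 2 + cosPartial k x) = Real.sin ((k + 1 / 2) * x) := by
  induction k with
  | zero => simp [cosPartial]; rw [show (2:ℝ)⁻¹ * x = x / 2 by ring]; ring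
  | succ k ih =>
    rw [cosPartial, sum_range_succ, ← add_assoc, show (1 / 2 + ∑ m ∈ range k, Real.cos ((m + 1 : ℕ) * x))
      = 1 / 2 + cosPartial k x from rfl, mul_add, ih]
    have h := Real.two_mul_sin_mul_cos (x / 2) ((k + 1 : ℕ) * x)
    rw [h]
    have e1 : x / 2 - (k + 1 : ℕ) * x = -((k + 1 / 2) * x) := by push_cast; ring
    have e2 : x / 2 + (k + 1 : ℕ) * x = ((k + 1 : ℕ) + 1 / 2) * x := by push_cast; ring
    rw [e1, e2, Real.sin_neg]
    push_cast
    ring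

/-- `|Σ_{m=1}^{k} cos(m x)| ≤ 1/(2|sin(x/2)|) + ½`. [folklore] -/
private theorem abs_cosPartial_le (k : ℕ) {x : ℝ} (hx : Real.sin (x / 2) ≠ 0) :
    |cosPartial k x| ≤ 1 / (2 * |Real.sin (x / 2)|) + 1 / 2 := by
  have h := two_sin_half_mul_cosPartial k x
  have hs : 0 < |Real.sin (x / 2)| := abs_pos.mpr hx
  have h2 : 2 * Real.sin (x / 2) ≠ 0 := mul_ne_zero two_ne_zero hx
  have : cosPartial k x = Real.sin ((k + 1 / 2) * x) / (2 * Real.sin (x / 2)) - 1 / 2 := by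
    rw [eq_sub_iff_add_eq, eq_div_iff h2, ← h]; ring
  rw [this]
  have h1 : |Real.sin ((k + 1 / 2) * x) / (2 * Real.sin (x / 2))| ≤ 1 / (2 * |Real.sin (x / 2)|) := by
    rw [abs_div, abs_mul, abs_two, div_le_div_iff₀ (by positivity) (by positivity)]
    nlinarith [Real.abs_sin_le_one ((k + 1 / 2) * x)]
  calc |Real.sin ((k + 1 / 2) * x) / (2 * Real.sin (x / 2)) - 1 / 2|
      ≤ |Real.sin ((k + 1 / 2) * x) / (2 * Real.sin (x / 2))| + |(1 / 2 : ℝ)| := abs_sub _ _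
    _ ≤ _ := by rw [abs_of_pos (by norm_num : (0:ℝ) < 1 / 2)]; linarith

/-! ### The cosine sum `C_n(x) ≥ −(π + 1)` by Abel summation -/

/-- **Abel summation bound**: if `|Σ_{j<i} g j| ≤ B` for all `i ≤ N` and `f ≥ 0` is non-increasing,
then `|Σ_{i<N} f i g i| ≤ B f 0`. [folklore] -/
private theorem abs_sum_mul_le_of_partial_bound {N : ℕ} {f g : ℕ → ℝ} {B : ℝ}
    (hB : ∀ i ≤ N, |∑ j ∈ range i, g j| ≤ B) (hf0 : ∀ i, 0 ≤ f i) (hf : Antitone f) :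
    |∑ i ∈ range N, f i * g i| ≤ B * f 0 := by
  have hB0 : 0 ≤ B := le_trans (abs_nonneg _) (hB 0 (Nat.zero_le _))
  rcases Nat.eq_zero_or_pos N with rfl | hN
  · simp only [range_zero, sum_empty, abs_zero]; exact mul_nonneg hB0 (hf0 0)
  -- Abel: Σ_{i<N} f i g i = f (N-1) G N - Σ_{i<N-1} (f (i+1) - f i) G (i+1)
  have habel := Finset.sum_range_by_parts f g N
  simp only [smul_eq_mul] at habel
  rw [habel]
  set G : ℕ → ℝ := fun k => ∑ j ∈ range k, g j with hG
  have h1 : |f (N - 1) * G N| ≤ f (N - 1) * B := by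
    rw [abs_mul, abs_of_nonneg (hf0 _)]
    exact mul_le_mul_of_nonneg_left (hB N le_rfl) (hf0 _)
  have h2 : |∑ i ∈ range (N - 1), (f (i + 1) - f i) * G (i + 1)| ≤ (f 0 - f (N - 1)) * B := by
    refine (abs_sum_le_sum_abs _ _).trans ?_
    have : ∀ i ∈ range (N - 1), |(f (i + 1) - f i) * G (i + 1)| ≤ (f i - f (i + 1)) * B := by
      intro i hi
      rw [abs_mul, abs_sub_comm, abs_of_nonneg (by linarith [hf (Nat.le_succ i)])]
      exact mul_le_mul_of_nonneg_left (hB (i + 1) (by rw [mem_range] at hi; omega))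
        (by linarith [hf (Nat.le_succ i)])
    refine (sum_le_sum this).trans ?_
    rw [← sum_mul, Finset.sum_range_sub' (f := f)]  -- Σ (f i - f (i+1)) = f 0 - f (N-1)
  calc |f (N - 1) * G N - ∑ i ∈ range (N - 1), (f (i + 1) - f i) * G (i + 1)|
      ≤ |f (N - 1) * G N| + |∑ i ∈ range (N - 1), (f (i + 1) - f i) * G (i + 1)| := abs_sub _ _
    _ ≤ f (N - 1) * B + (f 0 - f (N - 1)) * B := add_le_add h1 h2
    _ = B * f 0 := by ring

/-! ### The sawtooth: `|(π − y)/2 − Σ_{m≤n} sin(my)/m| ≤ 1/((n+½) sin(y/2))` on `(0, 2π)` -/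

/-- `½ + Σ_{m=1}^{n} cos(m t) = sin((n+½)t)/(2 sin(t/2))` where `sin(t/2) ≠ 0`. [folklore] -/
private theorem kernel_eq (n : ℕ) {t : ℝ} (ht : Real.sin (t / 2) ≠ 0) :
    1 / 2 + cosPartial n t = Real.sin ((n + 1 / 2) * t) / (2 * Real.sin (t / 2)) := by
  rw [eq_div_iff (mul_ne_zero two_ne_zero ht), ← two_sin_half_mul_cosPartial]; ring

/-- `d/dt P_n(t) = Σ_{m=1}^{n} cos(m t)`. [folklore] -/
private theorem hasDerivAt_sinSum (n : ℕ) (t : ℝ) : HasDerivAt (sinSum n) (cosPartial n t) t := by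
  unfold sinSum cosPartial
  have : (fun y : ℝ => ∑ m ∈ range n, Real.sin ((m + 1 : ℕ) * y) / (m + 1 : ℕ)) =
      fun y => ∑ m ∈ range n, (fun y => Real.sin ((m + 1 : ℕ) * y) / (m + 1 : ℕ)) y := rfl
  rw [this]
  refine HasDerivAt.fun_sum fun m _ => ?_
  set c : ℝ := ((m + 1 : ℕ) : ℝ) with hc
  have hc0 : c ≠ 0 := by rw [hc]; positivity
  have h1 : HasDerivAt (fun y : ℝ => c * y) c t := by
    simpa using (hasDerivAt_id t).const_mul c
  have h3 : HasDerivAt (fun y : ℝ => Real.sin (c * y) / c) (Real.cos (c * t) * c / c) t :=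
    h1.sin.div_const c
  exact h3.congr_deriv (by field_simp)

/-- `P_n(π) = 0`. [folklore] -/
private theorem sinSum_pi (n : ℕ) : sinSum n π = 0 := by
  unfold sinSum
  exact Finset.sum_eq_zero fun m _ => by rw [Real.sin_nat_mul_pi]; simp

/-- `P_n(2π − y) = −P_n(y)`. [folklore] -/
private theorem sinSum_two_pi_sub (n : ℕ) (y : ℝ) : sinSum n (2 * π - y) = -sinSum n y := by
  unfold sinSum
  rw [← sum_neg_distrib]
  refine Finset.sum_congr rfl fun m _ => ?_
  have : ((m + 1 : ℕ) : ℝ) * (2 * π - y) = -(((m + 1 : ℕ) : ℝ) * y) + (m + 1 : ℕ) * (2 * π) := by ring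
  rw [this, Real.sin_add_nat_mul_two_pi, Real.sin_neg, neg_div]

/-- `d/dt [(π − t)/2 − P_n(t)] = −(½ + Σ cos(m t))`. [folklore] -/
private theorem hasDerivAt_sawF (n : ℕ) (t : ℝ) :
    HasDerivAt (fun t : ℝ => (π - t) / 2 - sinSum n t) (-(1 / 2 + cosPartial n t)) t := by
  have h1 : HasDerivAt (fun t : ℝ => (π - t) / 2) ((0 - 1) / 2) t :=
    ((hasDerivAt_const t π).sub (hasDerivAt_id t)).div_const 2
  exact (h1.sub (hasDerivAt_sinSum n t)).congr_deriv (by ring)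

/-- `d/dt (2 sin(t/2))⁻¹ = −cos(t/2)/(2 sin(t/2))²` where `sin(t/2) ≠ 0`. [folklore] -/
private theorem hasDerivAt_invTwoSinHalf {t : ℝ} (ht : Real.sin (t / 2) ≠ 0) :
    HasDerivAt (fun t : ℝ => (2 * Real.sin (t / 2))⁻¹)
      (-Real.cos (t / 2) / (2 * Real.sin (t / 2)) ^ 2) t := by
  have h1 : HasDerivAt (fun t : ℝ => t / 2) (1 / 2) t := by
    simpa using (hasDerivAt_id t).div_const 2
  have hg : HasDerivAt (fun t : ℝ => 2 * Real.sin (t / 2)) (2 * (Real.cos (t / 2) * (1 / 2))) t :=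
    h1.sin.const_mul 2
  have hne : 2 * Real.sin (t / 2) ≠ 0 := mul_ne_zero two_ne_zero ht
  exact (hg.inv hne).congr_deriv (by field_simp)

/-- `d/dt (−cos(N t)/N) = sin(N t)` (`N ≠ 0`). [folklore] -/
private theorem hasDerivAt_negCosDiv {N : ℝ} (hN : N ≠ 0) (t : ℝ) :
    HasDerivAt (fun t : ℝ => -Real.cos (N * t) / N) (Real.sin (N * t)) t := by
  have h1 : HasDerivAt (fun t : ℝ => N * t) N t := by simpa using (hasDerivAt_id t).const_mul N
  have h2 : HasDerivAt (fun t : ℝ => Real.cos (N * t)) (-Real.sin (N * t) * N) t := h1.cos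
  exact (h2.neg.div_const N).congr_deriv (by field_simp)

/-- The tail bound on `(0, π]`. [folklore] -/
private theorem abs_sawtooth_sub_sinSum_le_of_le_pi (n : ℕ) {y : ℝ} (hy0 : 0 < y) (hyπ : y ≤ π) :
    |(π - y) / 2 - sinSum n y| ≤ 1 / ((n + 1 / 2) * Real.sin (y / 2)) := by
  -- abbreviations (plain functions, no `set`)
  have hN : (0 : ℝ) < n + 1 / 2 := by positivity
  have hsin : ∀ t ∈ Set.Icc y π, 0 < Real.sin (t / 2) := fun t ht =>
    Real.sin_pos_of_pos_of_lt_pi (by linarith [ht.1]) (by linarith [ht.2, Real.pi_pos])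
  have hsy : 0 < Real.sin (y / 2) := hsin y ⟨le_rfl, hyπ⟩
  have hIcc : Set.uIcc y π = Set.Icc y π := Set.uIcc_of_le hyπ
  -- FTC: `(π − y)/2 − P_n(y) = ∫_y^π (½ + Σ cos)`
  have hKcont : Continuous (fun t => -(1 / 2 + cosPartial n t)) := by unfold cosPartial; fun_prop
  have hFTC := intervalIntegral.integral_eq_sub_of_hasDerivAt (a := y) (b := π)
    (fun t _ => hasDerivAt_sawF n t) (hKcont.intervalIntegrable _ _)
  rw [sub_self, zero_div, sinSum_pi, sub_zero, zero_sub, intervalIntegral.integral_neg] at hFTC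
  have hFy : (π - y) / 2 - sinSum n y = ∫ t in y..π, (1 / 2 + cosPartial n t) := by linarith
  -- the kernel as `u · v'` on `[y, π]`
  have hK_eq : Set.EqOn (fun t => 1 / 2 + cosPartial n t)
      (fun t => (2 * Real.sin (t / 2))⁻¹ * Real.sin ((n + 1 / 2) * t)) (Set.uIcc y π) := by
    intro t ht
    rw [hIcc] at ht
    simp only
    rw [kernel_eq n (hsin t ht).ne', div_eq_inv_mul]
  have hint_eq := intervalIntegral.integral_congr (μ := volume) hK_eq
  -- derivatives and integrability on `[y, π]`
  have hu_deriv : ∀ t ∈ Set.uIcc y π, HasDerivAt (fun t : ℝ => (2 * Real.sin (t / 2))⁻¹)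
      (-Real.cos (t / 2) / (2 * Real.sin (t / 2)) ^ 2) t := by
    intro t ht
    rw [hIcc] at ht
    exact hasDerivAt_invTwoSinHalf (hsin t ht).ne'
  have hv_deriv : ∀ t ∈ Set.uIcc y π, HasDerivAt (fun t : ℝ => -Real.cos ((n + 1 / 2) * t) / (n + 1 / 2))
      (Real.sin ((n + 1 / 2) * t)) t := fun t _ => hasDerivAt_negCosDiv hN.ne' t
  have hu'_cont : ContinuousOn (fun t : ℝ => -Real.cos (t / 2) / (2 * Real.sin (t / 2)) ^ 2)
      (Set.uIcc y π) := by
    rw [hIcc]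
    refine ContinuousOn.div (by fun_prop) (by fun_prop) fun t ht => ?_
    exact pow_ne_zero 2 (mul_ne_zero two_ne_zero (hsin t ht).ne')
  have hv'_cont : Continuous (fun t : ℝ => Real.sin ((n + 1 / 2) * t)) := by fun_prop
  have hparts := intervalIntegral.integral_mul_deriv_eq_deriv_mul hu_deriv hv_deriv
    hu'_cont.intervalIntegrable (hv'_cont.intervalIntegrable _ _)
  -- `v(π) = 0`
  have hvπ : -Real.cos ((n + 1 / 2) * π) / (n + 1 / 2) = 0 := by
    have : Real.cos ((n + 1 / 2) * π) = 0 := by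
      rw [Real.cos_eq_zero_iff]
      exact ⟨n, by push_cast; ring⟩
    rw [this, neg_zero, zero_div]
  -- the boundary term at `y`
  have hbd : |(2 * Real.sin (y / 2))⁻¹ * (-Real.cos ((n + 1 / 2) * y) / (n + 1 / 2))| ≤
      (2 * Real.sin (y / 2))⁻¹ * (1 / (n + 1 / 2)) := by
    have huy0 : 0 < (2 * Real.sin (y / 2))⁻¹ := by positivity
    rw [abs_mul, abs_of_pos huy0]
    refine mul_le_mul_of_nonneg_left ?_ huy0.le
    rw [abs_div, abs_neg, abs_of_pos hN]
    exact div_le_div_of_nonneg_right (Real.abs_cos_le_one _) hN.le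
  -- the integral term
  have hu'_nonpos : ∀ t ∈ Set.Icc y π, -Real.cos (t / 2) / (2 * Real.sin (t / 2)) ^ 2 ≤ 0 := by
    intro t ht
    have hc : 0 ≤ Real.cos (t / 2) := Real.cos_nonneg_of_mem_Icc
      ⟨by linarith [ht.1, Real.pi_pos], by linarith [ht.2]⟩
    exact div_nonpos_of_nonpos_of_nonneg (neg_nonpos.mpr hc) (sq_nonneg _)
  have hFTCu := intervalIntegral.integral_eq_sub_of_hasDerivAt (a := y) (b := π)
    hu_deriv hu'_cont.intervalIntegrable
  have hint_bound : |∫ t in y..π, -Real.cos (t / 2) / (2 * Real.sin (t / 2)) ^ 2 *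
      (-Real.cos ((n + 1 / 2) * t) / (n + 1 / 2))| ≤
      ((2 * Real.sin (y / 2))⁻¹ - (2 * Real.sin (π / 2))⁻¹) / (n + 1 / 2) := by
    have h1 : |∫ t in y..π, -Real.cos (t / 2) / (2 * Real.sin (t / 2)) ^ 2 *
        (-Real.cos ((n + 1 / 2) * t) / (n + 1 / 2))| ≤
        ∫ t in y..π, -(-Real.cos (t / 2) / (2 * Real.sin (t / 2)) ^ 2) * (1 / (n + 1 / 2)) := by
      rw [← Real.norm_eq_abs]
      refine intervalIntegral.norm_integral_le_of_norm_le hyπ ?_ ?_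
      · refine Filter.Eventually.of_forall fun t ht => ?_
        have ht' : t ∈ Set.Icc y π := ⟨ht.1.le, ht.2⟩
        rw [Real.norm_eq_abs, abs_mul, abs_of_nonpos (hu'_nonpos t ht')]
        refine mul_le_mul_of_nonneg_left ?_ (neg_nonneg.mpr (hu'_nonpos t ht'))
        rw [abs_div, abs_neg, abs_of_pos hN]
        exact div_le_div_of_nonneg_right (Real.abs_cos_le_one _) hN.le
      · exact (hu'_cont.neg.mul continuousOn_const).intervalIntegrable
    refine h1.trans (le_of_eq ?_)
    rw [intervalIntegral.integral_mul_const, intervalIntegral.integral_neg, hFTCu]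
    ring
  -- assemble
  rw [hFy, hint_eq, hparts, hvπ, mul_zero, zero_sub]
  refine (abs_sub _ _).trans ?_
  rw [abs_neg]
  refine (add_le_add hbd hint_bound).trans ?_
  rw [Real.sin_pi_div_two]
  have e : (2 * Real.sin (y / 2))⁻¹ * (1 / (n + 1 / 2)) +
      ((2 * Real.sin (y / 2))⁻¹ - (2 * 1)⁻¹) / (n + 1 / 2) =
      1 / ((n + 1 / 2) * Real.sin (y / 2)) - 1 / (2 * (n + 1 / 2)) := by
    field_simp; ring
  rw [e]
  linarith [show 0 < 1 / (2 * ((n : ℝ) + 1 / 2)) by positivity]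

/-- **The sawtooth tail bound:** for `0 < y < 2π` and every `n`,
`|(π − y)/2 − Σ_{m=1}^{n} sin(m y)/m| ≤ 1/((n + ½) sin(y/2))` (Landau has `n + 1` for `n + ½`).
[cite: Pomerance2011, §2 proof of Lemma 4 («`|R_n(x)| ≤ 1/((n+1) sin(x/2))`»)] -/
theorem abs_sawtooth_sub_sinSum_le (n : ℕ) {y : ℝ} (hy0 : 0 < y) (hy : y < 2 * π) :
    |(π - y) / 2 - sinSum n y| ≤ 1 / ((n + 1 / 2) * Real.sin (y / 2)) := by
  rcases le_or_gt y π with h | h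
  · exact abs_sawtooth_sub_sinSum_le_of_le_pi n hy0 h
  · have h1 := abs_sawtooth_sub_sinSum_le_of_le_pi n (y := 2 * π - y) (by linarith) (by linarith)
    rw [sinSum_two_pi_sub] at h1
    have hs : Real.sin ((2 * π - y) / 2) = Real.sin (y / 2) := by
      rw [show (2 * π - y) / 2 = π - y / 2 by ring, Real.sin_pi_sub]
    rw [hs] at h1
    calc |(π - y) / 2 - sinSum n y| = |(π - (2 * π - y)) / 2 - -sinSum n y| := by
          rw [← abs_neg]; congr 1; ring
      _ ≤ _ := h1

/-! ### The cosine sum is bounded below: `C_n(x) ≥ −(π + 1)` -/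

/-- Shifted partial sums of cosines are differences of `cosPartial`. [folklore] -/
private theorem sum_range_cos_shift (k i : ℕ) (x : ℝ) :
    ∑ j ∈ range i, Real.cos ((k + j + 1 : ℕ) * x) = cosPartial (k + i) x - cosPartial k x := by
  unfold cosPartial
  rw [Finset.sum_range_add, add_sub_cancel_left]

/-- For `0 < x ≤ π`: `|Σ_{j<i} cos((k+j+1)x)| ≤ 1/sin(x/2) + 1`. [folklore] -/
private theorem abs_sum_range_cos_shift_le (k i : ℕ) {x : ℝ} (hs : 0 < Real.sin (x / 2)) :
    |∑ j ∈ range i, Real.cos ((k + j + 1 : ℕ) * x)| ≤ 1 / Real.sin (x / 2) + 1 := by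
  rw [sum_range_cos_shift]
  have h1 := abs_cosPartial_le (k + i) hs.ne'
  have h2 := abs_cosPartial_le k hs.ne'
  rw [abs_of_pos hs] at h1 h2
  calc |cosPartial (k + i) x - cosPartial k x| ≤ |cosPartial (k + i) x| + |cosPartial k x| :=
        abs_sub _ _
    _ ≤ (1 / (2 * Real.sin (x / 2)) + 1 / 2) + (1 / (2 * Real.sin (x / 2)) + 1 / 2) := add_le_add h1 h2
    _ = 1 / Real.sin (x / 2) + 1 := by field_simp; ring

/-- **`C_n(x) = Σ_{m=1}^{n} cos(m x)/m ≥ −(π + 1)` for `0 < x ≤ π`** (Abel summation beyond `m ≈ 1/x`,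
the terms with `m x ≤ 1` being non-negative; Jordan's inequality `sin(x/2) ≥ x/π`). Young's theorem
gives the sharp `−1` and [Pomerance2011] §2 Lemma 2 has `> −log 2 − 2/n`; any constant suffices for the
leading term here. [folklore] -/
private theorem cosSum_ge_of_pos_of_le_pi (n : ℕ) {x : ℝ} (hx0 : 0 < x) (hxπ : x ≤ π) :
    -(π + 1) ≤ cosSum n x := by
  have hπ := Real.pi_pos
  have hs : 0 < Real.sin (x / 2) :=
    Real.sin_pos_of_pos_of_lt_pi (by linarith) (by linarith)
  -- Jordan: `x/π ≤ sin(x/2)`, so `1/sin(x/2) ≤ π/x`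
  have hjordan : x / π ≤ Real.sin (x / 2) := by
    have := Real.mul_le_sin (x := x / 2) (by linarith) (by linarith)
    calc x / π = 2 / π * (x / 2) := by field_simp
      _ ≤ _ := this
  have hinv : 1 / Real.sin (x / 2) ≤ π / x := by
    rw [div_le_div_iff₀ hs hx0, one_mul]
    calc x = x / π * π := by field_simp
      _ ≤ Real.sin (x / 2) * π := mul_le_mul_of_nonneg_right hjordan hπ.le
      _ = π * Real.sin (x / 2) := mul_comm _ _
  set B : ℝ := 1 / Real.sin (x / 2) + 1 with hBdef
  have hB0 : 0 ≤ B := by positivity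
  -- the split index
  set k : ℕ := min n ⌊1 / x⌋₊ with hkdef
  have hkn : k ≤ n := min_le_left _ _
  have hsplit : cosSum n x = ∑ m ∈ range k, Real.cos ((m + 1 : ℕ) * x) / (m + 1 : ℕ) +
      ∑ j ∈ range (n - k), (1 / ((k + j + 1 : ℕ) : ℝ)) * Real.cos ((k + j + 1 : ℕ) * x) := by
    unfold cosSum
    rw [← Nat.add_sub_cancel' hkn, Finset.sum_range_add, Nat.add_sub_cancel' hkn]
    congr 1
    refine Finset.sum_congr rfl fun j _ => ?_
    ring
  -- the head is non-negative
  have hhead : 0 ≤ ∑ m ∈ range k, Real.cos ((m + 1 : ℕ) * x) / (m + 1 : ℕ) := by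
    refine Finset.sum_nonneg fun m hm => div_nonneg ?_ (by positivity)
    rw [mem_range] at hm
    have hm1 : (m + 1 : ℕ) ≤ ⌊1 / x⌋₊ := le_trans hm (min_le_right _ _)
    have hm2 : ((m + 1 : ℕ) : ℝ) ≤ 1 / x := by
      have := Nat.floor_le (show 0 ≤ 1 / x by positivity)
      exact le_trans (by exact_mod_cast hm1) this
    have hm3 : ((m + 1 : ℕ) : ℝ) * x ≤ 1 := by
      rw [le_div_iff₀ hx0] at hm2; exact hm2
    apply Real.cos_nonneg_of_mem_Icc
    constructor
    · have : 0 ≤ ((m + 1 : ℕ) : ℝ) * x := by positivity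
      linarith
    · linarith [Real.pi_gt_three]
  -- the tail by Abel summation
  have htail : |∑ j ∈ range (n - k), (1 / ((k + j + 1 : ℕ) : ℝ)) * Real.cos ((k + j + 1 : ℕ) * x)| ≤
      B * (1 / ((k + 0 + 1 : ℕ) : ℝ)) := by
    refine abs_sum_mul_le_of_partial_bound (f := fun j => 1 / ((k + j + 1 : ℕ) : ℝ))
      (g := fun j => Real.cos ((k + j + 1 : ℕ) * x)) (fun i _ => ?_) (fun i => by positivity) ?_
    · exact abs_sum_range_cos_shift_le k i hs
    · intro i j hij
      exact one_div_le_one_div_of_le (by positivity) (by exact_mod_cast (by omega : k + i + 1 ≤ k + j + 1))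
  have htail' : |∑ j ∈ range (n - k), (1 / ((k + j + 1 : ℕ) : ℝ)) * Real.cos ((k + j + 1 : ℕ) * x)| ≤
      π + 1 := by
    rcases lt_or_ge ⌊1 / x⌋₊ n with hfl | hfl
    · -- `k = ⌊1/x⌋`, so `1/(k+1) < x`
      have hk : k = ⌊1 / x⌋₊ := min_eq_right hfl.le
      have hkx : 1 / x < (k : ℝ) + 1 := by rw [hk]; exact Nat.lt_floor_add_one _
      have h1 : 1 / ((k + 0 + 1 : ℕ) : ℝ) ≤ x := by
        push_cast
        rw [add_zero, div_le_iff₀ (by positivity)]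
        rw [div_lt_iff₀ hx0] at hkx
        linarith
      have h1' : 1 / ((k + 0 + 1 : ℕ) : ℝ) ≤ 1 := by
        rw [div_le_one (by positivity)]; exact_mod_cast Nat.succ_le_succ (Nat.zero_le _)
      refine htail.trans ?_
      rcases le_or_gt x 1 with hx1 | hx1
      · calc B * (1 / ((k + 0 + 1 : ℕ) : ℝ)) ≤ B * x := mul_le_mul_of_nonneg_left h1 hB0
          _ = (1 / Real.sin (x / 2)) * x + x := by rw [hBdef]; ring
          _ ≤ π / x * x + x := by gcongr
          _ = π + x := by field_simp
          _ ≤ π + 1 := by linarith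
      · have hπx : π / x ≤ π := by
          rw [div_le_iff₀ hx0]; nlinarith
        calc B * (1 / ((k + 0 + 1 : ℕ) : ℝ)) ≤ B * 1 := mul_le_mul_of_nonneg_left h1' hB0
          _ = 1 / Real.sin (x / 2) + 1 := by rw [hBdef, mul_one]
          _ ≤ π / x + 1 := by linarith
          _ ≤ π + 1 := by linarith
    · -- `k = n`: the tail is empty
      have hk : k = n := min_eq_left hfl
      rw [hk, Nat.sub_self, sum_range_zero, abs_zero]
      positivity
  rw [hsplit]
  have := neg_abs_le (∑ j ∈ range (n - k), (1 / ((k + j + 1 : ℕ) : ℝ)) * Real.cos ((k + j + 1 : ℕ) * x))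
  linarith


/-- The discrete sawtooth on `ℤ/q`: `saw_q(j) = π/2 − π r/q` with `r = j mod q ∈ (0, q)`, and `0` when
`q ∣ j` (the value of `Σ_{m ≥ 1} sin(2π m j/q)/m`). [folklore] -/
def sawZ (q : ℕ) (j : ℤ) : ℝ := if (q : ℤ) ∣ j then 0 else π / 2 - π * ((j % q : ℤ) : ℝ) / q

variable {q : ℕ}

/-- `saw_q` is `q`-periodic. [folklore] -/
private theorem sawZ_add_nat_mul (_hq : 0 < q) (j t : ℤ) : sawZ q (j + q * t) = sawZ q j := by
  unfold sawZ
  have h1 : ((q : ℤ) ∣ j + q * t) ↔ ((q : ℤ) ∣ j) := by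
    constructor
    · intro h; simpa using h.sub (dvd_mul_right (q : ℤ) t)
    · intro h; exact h.add (dvd_mul_right _ _)
  have h2 : (j + q * t) % q = j % q := Int.add_mul_emod_self_left j q t
  simp only [h1, h2]

/-- `saw_q(k)` for `0 ≤ k < q`. [folklore] -/
private theorem sawZ_natCast_of_lt {k : ℕ} (hk : k < q) :
    sawZ q k = if k = 0 then 0 else π / 2 - π * k / q := by
  unfold sawZ
  by_cases h0 : k = 0
  · simp [h0]
  · have hnd : ¬ ((q : ℤ) ∣ (k : ℤ)) := by
      intro h
      have := Int.le_of_dvd (by exact_mod_cast Nat.pos_of_ne_zero h0) h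
      have : (q : ℤ) ≤ k := this
      omega
    have hmod : ((k : ℤ) % q : ℤ) = k := Int.emod_eq_of_lt (by positivity) (by exact_mod_cast hk)
    simp [h0, hnd, hmod]

/-- Region `0 < k < L ≤ q`: `saw_q(k) − saw_q(k − L) = π − π L/q`. [folklore] -/
private theorem sawZ_sub_of_pos_of_lt {L k : ℕ} (hLq : L ≤ q) (hk0 : 0 < k) (hkL : k < L) :
    sawZ q k - sawZ q ((k : ℤ) - L) = π - π * L / q := by
  have hq : 0 < q := by omega
  have hqR : (0 : ℝ) < q := by exact_mod_cast hq
  have hshift : sawZ q ((k : ℤ) - L) = sawZ q ((k + q - L : ℕ) : ℤ) := by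
    rw [← sawZ_add_nat_mul hq ((k : ℤ) - L) 1]
    congr 1
    push_cast [show L ≤ k + q by omega]
    ring
  rw [sawZ_natCast_of_lt (show k < q by omega), if_neg (by omega), hshift,
    sawZ_natCast_of_lt (by omega), if_neg (by omega)]
  push_cast [show L ≤ k + q by omega]
  field_simp
  ring

/-- `saw_q(0) = 0`. [folklore] -/
private theorem sawZ_zero : sawZ q 0 = 0 := by unfold sawZ; simp

/-- Region `k = 0`, `L < q`: `saw_q(0) − saw_q(−L) = π/2 − π L/q`. [folklore] -/
private theorem sawZ_sub_of_zero_of_lt {L : ℕ} (hL1 : 1 ≤ L) (hLq : L < q) :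
    sawZ q 0 - sawZ q (0 - (L : ℤ)) = π / 2 - π * L / q := by
  have hq : 0 < q := by omega
  have hqR : (0 : ℝ) < q := by exact_mod_cast hq
  have hshift : sawZ q (0 - (L : ℤ)) = sawZ q ((q - L : ℕ) : ℤ) := by
    rw [← sawZ_add_nat_mul hq (0 - (L : ℤ)) 1]
    congr 1
    push_cast [hLq.le]
    ring
  rw [sawZ_zero, hshift, sawZ_natCast_of_lt (by omega), if_neg (by omega)]
  push_cast [hLq.le]
  field_simp
  ring

/-- Region `k = 0`, `L = q`: `saw_q(0) − saw_q(−q) = 0`. [folklore] -/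
private theorem sawZ_sub_of_zero_of_eq (hq : 0 < q) :
    sawZ q 0 - sawZ q (0 - (q : ℤ)) = 0 := by
  have hshift : sawZ q (0 - (q : ℤ)) = sawZ q 0 := by
    rw [← sawZ_add_nat_mul hq (0 - (q : ℤ)) 1]
    congr 1
    ring
  rw [hshift, sub_self]

/-- Region `k = L < q`: `saw_q(L) − saw_q(0) = π/2 − π L/q`. [folklore] -/
private theorem sawZ_sub_of_eq_of_lt {L : ℕ} (hL1 : 1 ≤ L) (hLq : L < q) :
    sawZ q L - sawZ q ((L : ℤ) - L) = π / 2 - π * L / q := by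
  rw [sub_self, sawZ_natCast_of_lt hLq, if_neg (by omega),
    show ((0 : ℤ)) = ((0 : ℕ) : ℤ) by simp, sawZ_natCast_of_lt (by omega), if_pos rfl, sub_zero]

/-- Region `L < k < q`: `saw_q(k) − saw_q(k − L) = −π L/q`. [folklore] -/
private theorem sawZ_sub_of_gt {L k : ℕ} (hLk : L < k) (hkq : k < q) :
    sawZ q k - sawZ q ((k : ℤ) - L) = -(π * L / q) := by
  have hqR : (0 : ℝ) < q := by exact_mod_cast (show 0 < q by omega)
  have hshift : sawZ q ((k : ℤ) - L) = sawZ q ((k - L : ℕ) : ℤ) := by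
    congr 1; push_cast [hLk.le]; ring
  rw [sawZ_natCast_of_lt hkq, if_neg (by omega), hshift, sawZ_natCast_of_lt (by omega),
    if_neg (by omega)]
  push_cast [hLk.le]
  field_simp
  ring

/-- **The arc indicator on `ℤ/q` through the discrete sawtooth.** For `g : ℤ → ℂ`, `u ∈ ℤ` and
`1 ≤ L ≤ q` (with `g(u + q) = g(u)` when `L = q`):
`Σ_{k<q} g(u+k) (saw_q(k) − saw_q(k − L)) = π (g(u)/2 + Σ_{0<k<L} g(u+k) + g(u+L)/2) − (πL/q) Σ_{k<q} g(u+k)`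
— the finite form of `Φ(x) = (N−M)/q + (1/π)(S(x − 2πM/q) − S(x − 2πN/q))` for the indicator of an arc
with half weights at its ends. [cite: Pomerance2011, §2 (6) and §4 (first display)] -/
theorem sum_mul_sawZ_sub_sawZ (g : ℤ → ℂ) (u : ℤ) {L : ℕ} (hL1 : 1 ≤ L) (hLq : L ≤ q)
    (hper : L = q → g (u + q) = g u) :
    ∑ k ∈ range q, g (u + k) * ((sawZ q k - sawZ q ((k : ℤ) - L) : ℝ) : ℂ) =
      (π : ℂ) * (g u / 2 + ∑ k ∈ Ico 1 L, g (u + k) + g (u + L) / 2) -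
        (π * L / q : ℝ) * ∑ k ∈ range q, g (u + k) := by
  have hq : 0 < q := by omega
  -- peel off `k = 0`
  rw [Finset.range_eq_Ico, Finset.sum_eq_sum_Ico_succ_bot hq, Finset.sum_eq_sum_Ico_succ_bot hq]
  simp only [Nat.cast_zero, add_zero, zero_add]
  rcases lt_or_eq_of_le hLq with hLq' | hLq'
  · -- `L < q`: split `Ico 1 q = Ico 1 L ∪ {L} ∪ Ico (L+1) q`
    rw [← Finset.sum_Ico_consecutive _ hL1 hLq'.le, Finset.sum_eq_sum_Ico_succ_bot hLq',
      ← Finset.sum_Ico_consecutive (fun k : ℕ => g (u + k)) hL1 hLq'.le,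
      Finset.sum_eq_sum_Ico_succ_bot hLq' (f := fun k : ℕ => g (u + k))]
    rw [sawZ_sub_of_zero_of_lt hL1 hLq', sawZ_sub_of_eq_of_lt hL1 hLq']
    have h1 : ∑ k ∈ Ico 1 L, g (u + k) * ((sawZ q k - sawZ q ((k : ℤ) - L) : ℝ) : ℂ) =
        ∑ k ∈ Ico 1 L, g (u + k) * ((π - π * L / q : ℝ) : ℂ) := by
      refine Finset.sum_congr rfl fun k hk => ?_
      rw [Finset.mem_Ico] at hk
      rw [sawZ_sub_of_pos_of_lt hLq (by omega) hk.2]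
    have h2 : ∑ k ∈ Ico (L + 1) q, g (u + k) * ((sawZ q k - sawZ q ((k : ℤ) - L) : ℝ) : ℂ) =
        ∑ k ∈ Ico (L + 1) q, g (u + k) * ((-(π * L / q) : ℝ) : ℂ) := by
      refine Finset.sum_congr rfl fun k hk => ?_
      rw [Finset.mem_Ico] at hk
      rw [sawZ_sub_of_gt (by omega) hk.2]
    rw [h1, h2, ← Finset.sum_mul, ← Finset.sum_mul]
    push_cast
    ring
  · -- `L = q`
    subst hLq'
    rw [sawZ_sub_of_zero_of_eq hq]
    have h1 : ∑ k ∈ Ico 1 L, g (u + k) * ((sawZ L k - sawZ L ((k : ℤ) - L) : ℝ) : ℂ) = 0 := by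
      refine Finset.sum_eq_zero fun k hk => ?_
      rw [Finset.mem_Ico] at hk
      rw [sawZ_sub_of_pos_of_lt le_rfl (by omega) hk.2]
      have : (π - π * (L : ℝ) / L : ℝ) = 0 := by field_simp; ring
      rw [this]; simp
    rw [h1, hper rfl]
    have hL0 : (L : ℂ) ≠ 0 := by exact_mod_cast hq.ne'
    push_cast
    field_simp
    ring

/-! ### The tail of the discrete sawtooth over one period -/

variable [NeZero q]

/-- `P_n` is `2π`-periodic. [folklore] -/
private theorem sinSum_add_int_mul_two_pi (n : ℕ) (y : ℝ) (t : ℤ) :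
    sinSum n (y + t * (2 * π)) = sinSum n y := by
  unfold sinSum
  refine Finset.sum_congr rfl fun m _ => ?_
  have : ((m + 1 : ℕ) : ℝ) * (y + t * (2 * π)) =
      ((m + 1 : ℕ) : ℝ) * y + (((m + 1 : ℕ) : ℤ) * t : ℤ) * (2 * π) := by push_cast; ring
  rw [this, Real.sin_add_int_mul_two_pi]

/-- `P_n(2π j/q)` depends only on `j mod q`. [folklore] -/
private theorem sinSum_two_pi_intCast_div (n : ℕ) (j : ℤ) :
    sinSum n (2 * π * j / q) = sinSum n (2 * π * ((j : ZMod q).val : ℕ) / q) := by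
  have hq : (q : ℝ) ≠ 0 := by exact_mod_cast (NeZero.ne q)
  have hval : (((j : ZMod q).val : ℕ) : ℤ) = j % q := ZMod.val_intCast j
  have hj : (j : ℝ) = (((j : ZMod q).val : ℕ) : ℝ) + ((j / q : ℤ) : ℝ) * q := by
    have h := Int.emod_add_ediv_mul j q
    have : (j : ℝ) = ((j % q + j / q * q : ℤ) : ℝ) := by rw [h]
    rw [this]; push_cast; rw [← hval]; push_cast; ring
  rw [hj]
  have : 2 * π * ((((j : ZMod q).val : ℕ) : ℝ) + ((j / q : ℤ) : ℝ) * q) / q =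
      2 * π * (((j : ZMod q).val : ℕ) : ℝ) / q + ((j / q : ℤ) : ℝ) * (2 * π) := by
    field_simp
  rw [this, sinSum_add_int_mul_two_pi]

/-- `saw_q(j)` through the residue `r = j mod q ∈ [0, q)`. [folklore] -/
private theorem sawZ_eq_val (j : ℤ) :
    sawZ q j = if (j : ZMod q).val = 0 then 0 else π / 2 - π * ((j : ZMod q).val : ℕ) / q := by
  unfold sawZ
  have hval : (((j : ZMod q).val : ℕ) : ℤ) = j % q := ZMod.val_intCast j
  have hdvd : ((q : ℤ) ∣ j) ↔ (j : ZMod q).val = 0 := by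
    rw [ZMod.val_eq_zero, ZMod.intCast_zmod_eq_zero_iff_dvd]
  by_cases h : (j : ZMod q).val = 0
  · rw [if_pos (hdvd.mpr h), if_pos h]
  · rw [if_neg (mt hdvd.mp h), if_neg h]
    congr 2
    have : ((j % q : ℤ) : ℝ) = ((((j : ZMod q).val : ℕ) : ℤ) : ℝ) := by rw [hval]
    rw [this]; push_cast; ring

/-- The tail majorant `τ_n(r) = 1/((n + ½) sin(π r/q))` for `0 < r < q`, and `0` at `r = 0`. [folklore] -/
def tailB (n q r : ℕ) : ℝ := if r = 0 then 0 else 1 / ((n + 1 / 2) * Real.sin (π * r / q))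

/-- `τ_n(r) ≥ 0` for `r < q`. [folklore] -/
private theorem tailB_nonneg (n r : ℕ) (hr : r < q) : 0 ≤ tailB n q r := by
  unfold tailB
  split_ifs with h
  · exact le_rfl
  · have hqR : (0 : ℝ) < q := by exact_mod_cast Nat.pos_of_ne_zero (NeZero.ne q)
    have hrR : (0 : ℝ) < r := by exact_mod_cast Nat.pos_of_ne_zero h
    have hs : 0 < Real.sin (π * r / q) := by
      refine Real.sin_pos_of_pos_of_lt_pi (by positivity) ?_
      rw [div_lt_iff₀ hqR]
      have : (r : ℝ) < q := by exact_mod_cast hr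
      nlinarith [Real.pi_pos]
    positivity

/-- **The discrete sawtooth is its `n`-th partial Fourier sum up to `τ_n(j mod q)`:**
`|saw_q(j) − P_n(2π j/q)| ≤ τ_n(j mod q)`. [cite: Pomerance2011, §2 proof of Lemma 4] -/
theorem abs_sawZ_sub_sinSum_le (n : ℕ) (j : ℤ) :
    |sawZ q j - sinSum n (2 * π * j / q)| ≤ tailB n q (j : ZMod q).val := by
  have hqR : (0 : ℝ) < q := by exact_mod_cast Nat.pos_of_ne_zero (NeZero.ne q)
  rw [sawZ_eq_val, sinSum_two_pi_intCast_div, tailB]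
  set r : ℕ := (j : ZMod q).val with hr
  have hrq : r < q := ZMod.val_lt _
  by_cases h0 : r = 0
  · rw [if_pos h0, if_pos h0, h0]
    simp [sinSum]
  · rw [if_neg h0, if_neg h0]
    have hrR : (0 : ℝ) < r := by exact_mod_cast Nat.pos_of_ne_zero h0
    have hrq' : (r : ℝ) < q := by exact_mod_cast hrq
    set y : ℝ := 2 * π * r / q with hy
    have hy0 : 0 < y := by positivity
    have hy2 : y < 2 * π := by
      rw [hy, div_lt_iff₀ hqR]; nlinarith [Real.pi_pos]
    have h := abs_sawtooth_sub_sinSum_le n hy0 hy2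
    have e1 : π / 2 - π * (r : ℝ) / q = (π - y) / 2 := by rw [hy]; field_simp
    have e2 : π * (r : ℝ) / q = y / 2 := by rw [hy]; field_simp
    rw [e1, e2]
    exact h

/-- Sums over a full period are shift invariant (residues `u + k`, `k < q`, run over `ℤ/q`). [folklore] -/
private theorem sum_range_comp_intCast_add {A : Type*} [AddCommMonoid A] (F : ZMod q → A) (u : ℤ) :
    ∑ k ∈ range q, F (((u + k : ℤ) : ZMod q)) = ∑ r ∈ range q, F (r : ZMod q) := by
  have h1 : ∑ k ∈ range q, F (((u + k : ℤ) : ZMod q)) = ∑ k ∈ range q, (fun z : ZMod q => F ((u : ZMod q) + z)) (k : ZMod q) := by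
    refine Finset.sum_congr rfl fun k _ => ?_
    push_cast; rfl
  rw [h1, sum_range_eq_sum_zmod (fun z : ZMod q => F ((u : ZMod q) + z)), sum_range_eq_sum_zmod F]
  exact (Fintype.sum_equiv (Equiv.addLeft (u : ZMod q)) (fun z : ZMod q => F ((u : ZMod q) + z)) F
    fun z => rfl)

/-- The tail majorants over one period: `Σ_{k<q} τ_n((u + k − w) mod q) = (1/(n+½)) Σ_{0<r<q} 1/sin(πr/q)`.
[folklore] -/
private theorem sum_tailB_shift (n : ℕ) (u w : ℤ) :
    ∑ k ∈ range q, tailB n q (((u + k - w : ℤ) : ZMod q)).val =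
      1 / (n + 1 / 2) * ∑ r ∈ Ico 1 q, 1 / Real.sin (π * r / q) := by
  have h1 : ∑ k ∈ range q, tailB n q (((u + k - w : ℤ) : ZMod q)).val =
      ∑ k ∈ range q, (fun z : ZMod q => tailB n q z.val) ((((u - w) + k : ℤ) : ZMod q)) := by
    refine Finset.sum_congr rfl fun k _ => ?_
    congr 3; ring
  rw [h1, sum_range_comp_intCast_add (F := fun z : ZMod q => tailB n q z.val) (u - w)]
  rw [Finset.range_eq_Ico, Finset.sum_eq_sum_Ico_succ_bot (Nat.pos_of_ne_zero (NeZero.ne q)),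
    Finset.mul_sum]
  have h0 : tailB n q ((0 : ℕ) : ZMod q).val = 0 := by simp [tailB]
  rw [h0, zero_add]
  refine Finset.sum_congr rfl fun r hr => ?_
  rw [Finset.mem_Ico] at hr
  rw [ZMod.val_cast_of_lt hr.2, tailB, if_neg (by omega)]
  field_simp


/-! ### Character sums against the sawtooth partial sums: Gauss sums -/

/-- `e(m j/q)` is the standard additive character of `ℤ/q` at `m j`. [folklore] -/
private theorem e_intCast_mul_intCast_div (m j : ℤ) :
    e ((m : ℝ) * (j : ℝ) / q) = ZMod.stdAddChar ((m : ZMod q) * (j : ZMod q)) := by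
  have : ((m : ZMod q) * (j : ZMod q)) = (((m * j : ℤ)) : ZMod q) := by push_cast; ring
  rw [this, ZMod.stdAddChar_coe, e_eq_exp]
  congr 1; push_cast; ring

/-- **Shifted Gauss sums of a primitive character**: for integers `u, m`,
`Σ_{k<q} χ(u + k) e(m (u + k)/q) = τ(χ) χ⁻¹(m)` (all `m`, coprime to `q` or not).
[cite: Pomerance2011, §2 (7)] -/
theorem sum_char_shift_mul_e {χ : DirichletCharacter ℂ q} (hχ : χ.IsPrimitive) (u m : ℤ) :
    ∑ k ∈ range q, χ (((u + k : ℤ)) : ZMod q) * e ((m : ℝ) * ((u + k : ℤ) : ℝ) / q) =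
      gaussSum χ ZMod.stdAddChar * χ⁻¹ (m : ZMod q) := by
  have h1 : ∑ k ∈ range q, χ (((u + k : ℤ)) : ZMod q) * e ((m : ℝ) * ((u + k : ℤ) : ℝ) / q) =
      ∑ k ∈ range q, (fun z : ZMod q => χ z * ZMod.stdAddChar ((m : ZMod q) * z))
        (((u + k : ℤ)) : ZMod q) := by
    refine Finset.sum_congr rfl fun k _ => ?_
    rw [e_intCast_mul_intCast_div]
  rw [h1, sum_range_comp_intCast_add
    (F := fun z : ZMod q => χ z * ZMod.stdAddChar ((m : ZMod q) * z)) u]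
  have h2 := sum_inv_mul_e_eq (isPrimitive_inv hχ) m
  rw [inv_inv] at h2
  rw [← h2]
  refine Finset.sum_congr rfl fun r _ => ?_
  show χ (r : ZMod q) * ZMod.stdAddChar ((m : ZMod q) * (r : ZMod q)) =
    χ (r : ZMod q) * e ((r : ℝ) * (m : ℝ) / q)
  rw [e_div_eq_stdAddChar, mul_comm ((r : ℕ) : ZMod q) (m : ZMod q)]

/-- `sin(2π t) = (e(−t) − e(t)) i/2`. [folklore] -/
private theorem ofReal_sin_two_pi_mul (t : ℝ) :
    ((Real.sin (2 * π * t) : ℝ) : ℂ) = (e (-t) - e t) * Complex.I / 2 := by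
  have h := Complex.two_sin ((2 * π * t : ℝ) : ℂ)
  rw [← Complex.ofReal_sin] at h
  have hA : Complex.exp (-((2 * π * t : ℝ) : ℂ) * Complex.I) = e (-t) := by
    rw [e_eq_exp]; congr 1; push_cast; ring
  have hB : Complex.exp (((2 * π * t : ℝ) : ℂ) * Complex.I) = e t := by
    rw [e_eq_exp]; congr 1; push_cast; ring
  rw [hA, hB] at h
  rw [← h]; ring

/-- `cos(2π t) = (e(t) + e(−t))/2`. [folklore] -/
private theorem ofReal_cos_two_pi_mul (t : ℝ) :
    ((Real.cos (2 * π * t) : ℝ) : ℂ) = (e t + e (-t)) / 2 := by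
  have h := Complex.two_cos ((2 * π * t : ℝ) : ℂ)
  rw [← Complex.ofReal_cos] at h
  have hA : Complex.exp (-((2 * π * t : ℝ) : ℂ) * Complex.I) = e (-t) := by
    rw [e_eq_exp]; congr 1; push_cast; ring
  have hB : Complex.exp (((2 * π * t : ℝ) : ℂ) * Complex.I) = e t := by
    rw [e_eq_exp]; congr 1; push_cast; ring
  rw [hA, hB] at h
  rw [← h]; ring

/-- **Odd primitive characters against sines** ([Pomerance2011] §2 (9)–(10):
`χ̄(m) τ(χ) = i Σ_a χ(a) sin(2πam/q)` for `χ` odd, shifted by `w`): for `χ` primitive and odd mod `q`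
and integers `u, w, m`, `Σ_{k<q} χ(u + k) sin(2π m (u + k − w)/q) = −i τ(χ) χ⁻¹(m) cos(2π m w/q)`.
[cite: Pomerance2011, §2 (9)–(10)] -/
theorem sum_char_shift_mul_sin {χ : DirichletCharacter ℂ q} (hχ : χ.IsPrimitive) (hodd : χ.Odd)
    (u w m : ℤ) :
    ∑ k ∈ range q, χ (((u + k : ℤ)) : ZMod q) *
        ((Real.sin (2 * π * ((m : ℝ) * ((u + k - w : ℤ) : ℝ) / q)) : ℝ) : ℂ) =
      -Complex.I * (gaussSum χ ZMod.stdAddChar * χ⁻¹ (m : ZMod q)) *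
        ((Real.cos (2 * π * ((m : ℝ) * (w : ℝ) / q)) : ℝ) : ℂ) := by
  have hτ := sum_char_shift_mul_e hχ u m
  have hτ' := sum_char_shift_mul_e hχ u (-m)
  have hodd' : χ (-1) = -1 := hodd
  have hneg : χ⁻¹ ((-m : ℤ) : ZMod q) = -χ⁻¹ (m : ZMod q) := by
    rw [Int.cast_neg, neg_eq_neg_one_mul, map_mul, inv_apply_neg_one, hodd']; ring
  rw [hneg] at hτ'
  have hterm : ∀ k : ℕ, χ (((u + k : ℤ)) : ZMod q) *
      ((Real.sin (2 * π * ((m : ℝ) * ((u + k - w : ℤ) : ℝ) / q)) : ℝ) : ℂ) =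
      χ (((u + k : ℤ)) : ZMod q) * e (((-m : ℤ) : ℝ) * ((u + k : ℤ) : ℝ) / q) *
          (e ((m : ℝ) * (w : ℝ) / q) * Complex.I / 2) -
        χ (((u + k : ℤ)) : ZMod q) * e ((m : ℝ) * ((u + k : ℤ) : ℝ) / q) *
          (e (-((m : ℝ) * (w : ℝ) / q)) * Complex.I / 2) := by
    intro k
    rw [ofReal_sin_two_pi_mul]
    have e1 : e (-((m : ℝ) * ((u + k - w : ℤ) : ℝ) / q)) =
        e (((-m : ℤ) : ℝ) * ((u + k : ℤ) : ℝ) / q) * e ((m : ℝ) * (w : ℝ) / q) := by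
      rw [← e_add]; congr 1; push_cast; ring
    have e2 : e ((m : ℝ) * ((u + k - w : ℤ) : ℝ) / q) =
        e ((m : ℝ) * ((u + k : ℤ) : ℝ) / q) * e (-((m : ℝ) * (w : ℝ) / q)) := by
      rw [← e_add]; congr 1; push_cast; ring
    rw [e1, e2]; ring
  rw [Finset.sum_congr rfl fun k _ => hterm k, Finset.sum_sub_distrib, ← Finset.sum_mul,
    ← Finset.sum_mul, hτ, hτ', ofReal_cos_two_pi_mul]
  ring

/-- **The character sum against the sawtooth partial sum**: for `χ` primitive and odd mod `q`,
integers `u, w` and `n ≥ 0`,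
`Σ_{k<q} χ(u + k) P_n(2π (u + k − w)/q) = −i τ(χ) Σ_{m=1}^{n} (χ⁻¹(m)/m) cos(2π m w/q)`.
[cite: Pomerance2011, §4 (display for `C_n`)] -/
theorem sum_char_shift_mul_sinSum {χ : DirichletCharacter ℂ q} (hχ : χ.IsPrimitive) (hodd : χ.Odd)
    (n : ℕ) (u w : ℤ) :
    ∑ k ∈ range q, χ (((u + k : ℤ)) : ZMod q) *
        ((sinSum n (2 * π * ((u + k - w : ℤ) : ℝ) / q) : ℝ) : ℂ) =
      -Complex.I * gaussSum χ ZMod.stdAddChar *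
        ∑ m ∈ range n, χ⁻¹ ((m + 1 : ℕ) : ZMod q) / ((m + 1 : ℕ) : ℂ) *
          ((Real.cos ((m + 1 : ℕ) * (2 * π * w / q)) : ℝ) : ℂ) := by
  -- expand `P_n` and interchange the sums
  have hexp : ∀ k : ℕ, ((sinSum n (2 * π * ((u + k - w : ℤ) : ℝ) / q) : ℝ) : ℂ) =
      ∑ m ∈ range n, ((Real.sin (2 * π * ((((m + 1 : ℕ) : ℤ) : ℝ) * ((u + k - w : ℤ) : ℝ) / q))
        : ℝ) : ℂ) / ((m + 1 : ℕ) : ℂ) := by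
    intro k
    unfold sinSum
    rw [Complex.ofReal_sum]
    refine Finset.sum_congr rfl fun m _ => ?_
    have : ((m + 1 : ℕ) : ℝ) * (2 * π * ((u + k - w : ℤ) : ℝ) / q) =
        2 * π * ((((m + 1 : ℕ) : ℤ) : ℝ) * ((u + k - w : ℤ) : ℝ) / q) := by push_cast; ring
    rw [this, Complex.ofReal_div, Complex.ofReal_natCast]
  simp_rw [hexp, Finset.mul_sum]
  rw [Finset.sum_comm]
  refine Finset.sum_congr rfl fun m _ => ?_
  have h := sum_char_shift_mul_sin hχ hodd u w ((m + 1 : ℕ) : ℤ)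
  have : ∑ k ∈ range q, χ (((u + k : ℤ)) : ZMod q) *
      (((Real.sin (2 * π * ((((m + 1 : ℕ) : ℤ) : ℝ) * ((u + k - w : ℤ) : ℝ) / q)) : ℝ) : ℂ) /
        ((m + 1 : ℕ) : ℂ)) =
      (∑ k ∈ range q, χ (((u + k : ℤ)) : ZMod q) *
        ((Real.sin (2 * π * ((((m + 1 : ℕ) : ℤ) : ℝ) * ((u + k - w : ℤ) : ℝ) / q)) : ℝ) : ℂ)) /
        ((m + 1 : ℕ) : ℂ) := by
    rw [Finset.sum_div]
    exact Finset.sum_congr rfl fun k _ => by ring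
  rw [this, h]
  simp only [Int.cast_natCast]
  have hc : Real.cos (2 * π * (((m + 1 : ℕ) : ℝ) * (w : ℝ) / q)) =
      Real.cos ((m + 1 : ℕ) * (2 * π * w / q)) := by
    congr 1; ring
  rw [hc]
  ring

/-! ### The cosine sums at the points `2π j/q` -/

/-- `|cos A − cos B| ≤ 1 − (cos(A + B) + cos(A − B))/2`
(AM–GM on `|cos A − cos B| = 2|sin((A+B)/2) sin((A−B)/2)|`; [Pomerance2011] §4 uses Cauchy–Schwarz
to the same end). [folklore] -/
private theorem abs_cos_sub_cos_le (A B : ℝ) :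
    |Real.cos A - Real.cos B| ≤ 1 - (Real.cos (A + B) + Real.cos (A - B)) / 2 := by
  have hAB : Real.cos (A + B) = 1 - 2 * Real.sin ((A + B) / 2) ^ 2 := by
    have h := Real.cos_two_mul ((A + B) / 2)
    rw [show 2 * ((A + B) / 2) = A + B by ring] at h
    linarith [Real.sin_sq_add_cos_sq ((A + B) / 2)]
  have hAB' : Real.cos (A - B) = 1 - 2 * Real.sin ((A - B) / 2) ^ 2 := by
    have h := Real.cos_two_mul ((A - B) / 2)
    rw [show 2 * ((A - B) / 2) = A - B by ring] at h
    linarith [Real.sin_sq_add_cos_sq ((A - B) / 2)]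
  rw [Real.cos_sub_cos, hAB, hAB', abs_le]
  constructor
  · nlinarith [sq_nonneg (Real.sin ((A + B) / 2) - Real.sin ((A - B) / 2))]
  · nlinarith [sq_nonneg (Real.sin ((A + B) / 2) + Real.sin ((A - B) / 2))]

/-- `C_n` is `2π`-periodic. [folklore] -/
private theorem cosSum_add_int_mul_two_pi (n : ℕ) (x : ℝ) (t : ℤ) :
    cosSum n (x + t * (2 * π)) = cosSum n x := by
  unfold cosSum
  refine Finset.sum_congr rfl fun m _ => ?_
  have : ((m + 1 : ℕ) : ℝ) * (x + t * (2 * π)) =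
      ((m + 1 : ℕ) : ℝ) * x + (((m + 1 : ℕ) : ℤ) * t : ℤ) * (2 * π) := by push_cast; ring
  rw [this, Real.cos_add_int_mul_two_pi]

/-- `C_n(2π − x) = C_n(x)`. [folklore] -/
private theorem cosSum_two_pi_sub (n : ℕ) (x : ℝ) : cosSum n (2 * π - x) = cosSum n x := by
  unfold cosSum
  refine Finset.sum_congr rfl fun m _ => ?_
  have : ((m + 1 : ℕ) : ℝ) * (2 * π - x) = -(((m + 1 : ℕ) : ℝ) * x) + (m + 1 : ℕ) * (2 * π) := by
    ring
  rw [this, Real.cos_add_nat_mul_two_pi, Real.cos_neg]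

/-- `C_n(0) = H_n ≥ 0`. [folklore] -/
private theorem cosSum_zero_nonneg (n : ℕ) : 0 ≤ cosSum n 0 := by
  unfold cosSum
  exact Finset.sum_nonneg fun m _ => by rw [mul_zero, Real.cos_zero]; positivity

/-- **`C_n(2π j/q) ≥ −(π + 1)`** for every integer `j` (reduce `j mod q`, use evenness on `(π, 2π)`).
[folklore] -/
private theorem neg_pi_add_one_le_cosSum (n : ℕ) (j : ℤ) : -(π + 1) ≤ cosSum n (2 * π * j / q) := by
  have hπ := Real.pi_pos
  have hqR : (0 : ℝ) < q := by exact_mod_cast Nat.pos_of_ne_zero (NeZero.ne q)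
  -- reduce to the residue `r = j mod q`
  have hval : (((j : ZMod q).val : ℕ) : ℤ) = j % q := ZMod.val_intCast j
  have hj : (j : ℝ) = (((j : ZMod q).val : ℕ) : ℝ) + ((j / q : ℤ) : ℝ) * q := by
    have h := Int.emod_add_ediv_mul j q
    have : (j : ℝ) = ((j % q + j / q * q : ℤ) : ℝ) := by rw [h]
    rw [this]; push_cast; rw [← hval]; push_cast; ring
  have hred : cosSum n (2 * π * j / q) = cosSum n (2 * π * ((j : ZMod q).val : ℕ) / q) := by
    rw [hj]
    have : 2 * π * ((((j : ZMod q).val : ℕ) : ℝ) + ((j / q : ℤ) : ℝ) * q) / q =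
        2 * π * (((j : ZMod q).val : ℕ) : ℝ) / q + ((j / q : ℤ) : ℝ) * (2 * π) := by
      field_simp
    rw [this, cosSum_add_int_mul_two_pi]
  rw [hred]
  set r : ℕ := (j : ZMod q).val with hr
  have hrq : (r : ℝ) < q := by exact_mod_cast ZMod.val_lt (j : ZMod q)
  rcases Nat.eq_zero_or_pos r with h0 | hpos
  · rw [h0, Nat.cast_zero, mul_zero, zero_div]
    linarith [cosSum_zero_nonneg n]
  · have hrR : (0 : ℝ) < r := by exact_mod_cast hpos
    set x : ℝ := 2 * π * r / q with hx
    have hx0 : 0 < x := by positivity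
    have hx2 : x < 2 * π := by rw [hx, div_lt_iff₀ hqR]; nlinarith
    rcases le_or_gt x π with hle | hgt
    · exact cosSum_ge_of_pos_of_le_pi n hx0 hle
    · rw [← cosSum_two_pi_sub]
      exact cosSum_ge_of_pos_of_le_pi n (by linarith) (by linarith)

/-- **The main-term estimate**: for reals `α, β` of the form `2π u/q, 2π v/q` (`u, v ∈ ℤ`),
`Σ_{m=1}^{n} |cos(m α) − cos(m β)|/m ≤ H_n + π + 1` ([Pomerance2011] §4 gets `log n + γ + log 2 + 3/n`
by the same splitting and Lemma 2). [cite: Pomerance2011, §4 (the chain for `Σ |cos mα − cos mβ|/m`)] -/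
theorem sum_abs_cos_sub_cos_div_le (n : ℕ) (u v : ℤ) :
    ∑ m ∈ range n, |Real.cos ((m + 1 : ℕ) * (2 * π * u / q)) - Real.cos ((m + 1 : ℕ) * (2 * π * v / q))|
        / ((m + 1 : ℕ) : ℝ) ≤
      ∑ m ∈ range n, 1 / ((m + 1 : ℕ) : ℝ) + (π + 1) := by
  have h1 : ∀ m ∈ range n,
      |Real.cos ((m + 1 : ℕ) * (2 * π * u / q)) - Real.cos ((m + 1 : ℕ) * (2 * π * v / q))|
        / ((m + 1 : ℕ) : ℝ) ≤
      1 / ((m + 1 : ℕ) : ℝ) - (Real.cos ((m + 1 : ℕ) * (2 * π * ((u + v : ℤ) : ℝ) / q)) / (m + 1 : ℕ)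
        + Real.cos ((m + 1 : ℕ) * (2 * π * ((u - v : ℤ) : ℝ) / q)) / (m + 1 : ℕ)) / 2 := by
    intro m _
    have hm : (0 : ℝ) < ((m + 1 : ℕ) : ℝ) := by positivity
    have h := abs_cos_sub_cos_le ((m + 1 : ℕ) * (2 * π * u / q)) ((m + 1 : ℕ) * (2 * π * v / q))
    have ea : (m + 1 : ℕ) * (2 * π * u / q) + (m + 1 : ℕ) * (2 * π * v / q) =
        (m + 1 : ℕ) * (2 * π * ((u + v : ℤ) : ℝ) / q) := by push_cast; ring
    have eb : (m + 1 : ℕ) * (2 * π * u / q) - (m + 1 : ℕ) * (2 * π * v / q) =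
        (m + 1 : ℕ) * (2 * π * ((u - v : ℤ) : ℝ) / q) := by push_cast; ring
    rw [ea, eb] at h
    rw [div_le_iff₀ hm]
    have : (1 / ((m + 1 : ℕ) : ℝ) - (Real.cos ((m + 1 : ℕ) * (2 * π * ((u + v : ℤ) : ℝ) / q)) / (m + 1 : ℕ)
        + Real.cos ((m + 1 : ℕ) * (2 * π * ((u - v : ℤ) : ℝ) / q)) / (m + 1 : ℕ)) / 2) * ((m + 1 : ℕ) : ℝ)
        = 1 - (Real.cos ((m + 1 : ℕ) * (2 * π * ((u + v : ℤ) : ℝ) / q))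
          + Real.cos ((m + 1 : ℕ) * (2 * π * ((u - v : ℤ) : ℝ) / q))) / 2 := by
      field_simp
    rw [this]; exact h
  refine (Finset.sum_le_sum h1).trans ?_
  rw [Finset.sum_sub_distrib, ← Finset.sum_div, Finset.sum_add_distrib]
  have hc1 := neg_pi_add_one_le_cosSum (q := q) n (u + v)
  have hc2 := neg_pi_add_one_le_cosSum (q := q) n (u - v)
  unfold cosSum at hc1 hc2
  linarith


/-! ### Assembly -/

/-- An odd character has modulus `q ≥ 3` (mod `1` and `2`, `−1 = 1`; [Pomerance2011] §2: "Suppose that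
`χ` is primitive with modulus `q > 1` (and so `q ≥ 3`)"). [cite: Pomerance2011, §2 (before (8))] -/
theorem three_le_of_odd {χ : DirichletCharacter ℂ q} (hodd : χ.Odd) : 3 ≤ q := by
  have hodd' : χ (-1) = -1 := hodd
  by_contra h
  have hq : q = 1 ∨ q = 2 := by have := NeZero.ne q; omega
  have hneg : (-1 : ZMod q) = 1 := by
    rcases hq with rfl | rfl <;> decide
  rw [hneg, map_one] at hodd'
  norm_num at hodd'

omit [NeZero q] in
/-- An odd character is not the trivial character. [folklore] -/
private theorem ne_one_of_odd {χ : DirichletCharacter ℂ q} (hodd : χ.Odd) : χ ≠ 1 := by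
  have hodd' : χ (-1) = -1 := hodd
  intro h
  rw [h, MulChar.one_apply (isUnit_one.neg)] at hodd'
  norm_num at hodd'

/-- A non-principal character sums to zero over any full period `u, u+1, …, u+q−1`. [folklore] -/
private theorem sum_char_shift_eq_zero {χ : DirichletCharacter ℂ q} (hχ1 : χ ≠ 1) (u : ℤ) :
    ∑ k ∈ range q, χ (((u + k : ℤ)) : ZMod q) = 0 := by
  rw [sum_range_comp_intCast_add (F := fun z : ZMod q => χ z) u, sum_range_eq_sum_zmod (fun z => χ z)]
  exact MulChar.sum_eq_zero_of_ne_one hχ1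

/-- **The tail over one period**: `|Σ_{k<q} χ(u+k) (saw_q − P_n)(u + k − w)| ≤ (1/(n+½)) Σ_{0<r<q} csc(πr/q)`.
[cite: Pomerance2011, §2 Lemma 4, (4)] -/
theorem norm_sum_char_mul_tail_le (n : ℕ) (χ : DirichletCharacter ℂ q) (u w : ℤ) :
    ‖∑ k ∈ range q, χ (((u + k : ℤ)) : ZMod q) *
        ((sawZ q ((u + k : ℤ) - w) - sinSum n (2 * π * (((u + k : ℤ) - w : ℤ) : ℝ) / q) : ℝ) : ℂ)‖ ≤
      1 / (n + 1 / 2) * ∑ r ∈ Ico 1 q, 1 / Real.sin (π * r / q) := by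
  rw [← sum_tailB_shift n u w]
  refine (norm_sum_le _ _).trans (Finset.sum_le_sum fun k _ => ?_)
  rw [norm_mul, Complex.norm_real, Real.norm_eq_abs]
  calc ‖χ (((u + k : ℤ)) : ZMod q)‖ *
        |sawZ q ((u + k : ℤ) - w) - sinSum n (2 * π * (((u + k : ℤ) - w : ℤ) : ℝ) / q)|
      ≤ 1 * |sawZ q ((u + k : ℤ) - w) - sinSum n (2 * π * (((u + k : ℤ) - w : ℤ) : ℝ) / q)| :=
        mul_le_mul_of_nonneg_right (χ.norm_le_one _) (abs_nonneg _)
    _ ≤ tailB n q ((((u + k : ℤ) - w : ℤ) : ZMod q)).val := by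
        rw [one_mul]; exact abs_sawZ_sub_sinSum_le n ((u + k : ℤ) - w)

/-- `|τ(χ)| = √q` for primitive `χ` (the tree's `norm_gaussSum_sq`). [cite: Pomerance2011, §2 (7)] -/
theorem norm_gaussSum_eq_sqrt {χ : DirichletCharacter ℂ q} (hχ : χ.IsPrimitive) :
    ‖gaussSum χ ZMod.stdAddChar‖ = Real.sqrt q := by
  rw [← Real.sqrt_sq (norm_nonneg _), norm_gaussSum_sq hχ]

/-- **The main term over one period**: for `χ` primitive and odd mod `q`,
`|Σ_{k<q} χ(u+k) (P_n(2π(u+k−w₁)/q) − P_n(2π(u+k−w₂)/q))| ≤ √q (H_n + π + 1)`.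
[cite: Pomerance2011, §4 (estimate of `C_n`)] -/
theorem norm_sum_char_mul_sinSum_sub_le {χ : DirichletCharacter ℂ q} (hχ : χ.IsPrimitive)
    (hodd : χ.Odd) (n : ℕ) (u w₁ w₂ : ℤ) :
    ‖∑ k ∈ range q, χ (((u + k : ℤ)) : ZMod q) *
        ((sinSum n (2 * π * ((u + k - w₁ : ℤ) : ℝ) / q) -
          sinSum n (2 * π * ((u + k - w₂ : ℤ) : ℝ) / q) : ℝ) : ℂ)‖ ≤
      Real.sqrt q * (∑ m ∈ range n, 1 / ((m + 1 : ℕ) : ℝ) + (π + 1)) := by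
  have h1 := sum_char_shift_mul_sinSum hχ hodd n u w₁
  have h2 := sum_char_shift_mul_sinSum hχ hodd n u w₂
  have hsplit : ∑ k ∈ range q, χ (((u + k : ℤ)) : ZMod q) *
        ((sinSum n (2 * π * ((u + k - w₁ : ℤ) : ℝ) / q) -
          sinSum n (2 * π * ((u + k - w₂ : ℤ) : ℝ) / q) : ℝ) : ℂ) =
      ∑ k ∈ range q, χ (((u + k : ℤ)) : ZMod q) *
          ((sinSum n (2 * π * ((u + k - w₁ : ℤ) : ℝ) / q) : ℝ) : ℂ) -
        ∑ k ∈ range q, χ (((u + k : ℤ)) : ZMod q) *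
          ((sinSum n (2 * π * ((u + k - w₂ : ℤ) : ℝ) / q) : ℝ) : ℂ) := by
    rw [← Finset.sum_sub_distrib]
    refine Finset.sum_congr rfl fun k _ => ?_
    rw [Complex.ofReal_sub, mul_sub]
  rw [hsplit, h1, h2, ← mul_sub, ← Finset.sum_sub_distrib, norm_mul, norm_mul, norm_neg,
    Complex.norm_I, one_mul, norm_gaussSum_eq_sqrt hχ]
  refine mul_le_mul_of_nonneg_left ?_ (Real.sqrt_nonneg _)
  refine (norm_sum_le _ _).trans ?_
  refine le_trans (Finset.sum_le_sum fun m _ => ?_) (sum_abs_cos_sub_cos_div_le (q := q) n w₁ w₂)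
  rw [← mul_sub, ← Complex.ofReal_sub, norm_mul, norm_div, Complex.norm_real, Complex.norm_natCast,
    Real.norm_eq_abs]
  have hm : (0 : ℝ) < ((m + 1 : ℕ) : ℝ) := by positivity
  rw [div_mul_eq_mul_div, div_le_div_iff_of_pos_right hm]
  calc ‖χ⁻¹ ((m + 1 : ℕ) : ZMod q)‖ *
        |Real.cos ((m + 1 : ℕ) * (2 * π * w₁ / q)) - Real.cos ((m + 1 : ℕ) * (2 * π * w₂ / q))|
      ≤ 1 * |Real.cos ((m + 1 : ℕ) * (2 * π * w₁ / q)) - Real.cos ((m + 1 : ℕ) * (2 * π * w₂ / q))| :=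
        mul_le_mul_of_nonneg_right (χ⁻¹.norm_le_one _) (abs_nonneg _)
    _ = _ := one_mul _


/-- **One block of fewer than `q` consecutive values, truncation `n` free**: for `χ` primitive and odd
mod `q`, an integer `u` and `1 ≤ L ≤ q`,
`|Σ_{0<k<L} χ(u+k)| ≤ 1 + (√q (H_n + π + 1) + (2/(n+½)) Σ_{0<r<q} csc(πr/q))/π`
(Landau–Pomerance: the arc indicator with half weights at its ends is `(1/π)(saw_q(k) − saw_q(k−L))`
plus a constant, `saw_q = P_n +` tail). [cite: Pomerance2011, §4 (first two displays), §2 Lemma 4] -/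
theorem norm_sum_char_block_le_raw {χ : DirichletCharacter ℂ q} (hχ : χ.IsPrimitive) (hodd : χ.Odd)
    (u : ℤ) {L : ℕ} (hL1 : 1 ≤ L) (hLq : L ≤ q) (n : ℕ) :
    ‖∑ k ∈ Ico 1 L, χ (((u + k : ℤ)) : ZMod q)‖ ≤
      1 + (Real.sqrt q * (∑ m ∈ range n, 1 / ((m + 1 : ℕ) : ℝ) + (π + 1)) +
        2 * (1 / (n + 1 / 2) * ∑ r ∈ Ico 1 q, 1 / Real.sin (π * r / q))) / π := by
  have hπ := Real.pi_pos
  set g : ℤ → ℂ := fun z => χ ((z : ZMod q)) with hg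
  have hper : L = q → g (u + q) = g u := by
    intro _; simp only [hg]; push_cast; rw [ZMod.natCast_self, add_zero]
  have hid := sum_mul_sawZ_sub_sawZ g u hL1 hLq hper
  have hzero : ∑ k ∈ range q, g (u + k) = 0 := sum_char_shift_eq_zero (ne_one_of_odd hodd) u
  rw [hzero, mul_zero, sub_zero] at hid
  -- decompose `saw_q(k) − saw_q(k − L)` into main part and two tails
  have hdec : ∀ k : ℕ, ((sawZ q k - sawZ q ((k : ℤ) - L) : ℝ) : ℂ) =
      ((sinSum n (2 * π * ((u + k - u : ℤ) : ℝ) / q) -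
          sinSum n (2 * π * ((u + k - (u + L) : ℤ) : ℝ) / q) : ℝ) : ℂ)
      + ((sawZ q ((u + k : ℤ) - u) - sinSum n (2 * π * (((u + k : ℤ) - u : ℤ) : ℝ) / q) : ℝ) : ℂ)
      - ((sawZ q ((u + k : ℤ) - (u + L)) -
          sinSum n (2 * π * (((u + k : ℤ) - (u + L) : ℤ) : ℝ) / q) : ℝ) : ℂ) := by
    intro k
    have e1 : sawZ q k = sawZ q ((u + k : ℤ) - u) := by congr 1; ring
    have e2 : sawZ q ((k : ℤ) - L) = sawZ q ((u + k : ℤ) - (u + L)) := by congr 1; ring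
    rw [e1, e2]; push_cast; ring
  have hsum : ∑ k ∈ range q, g (u + k) * ((sawZ q k - sawZ q ((k : ℤ) - L) : ℝ) : ℂ) =
      ∑ k ∈ range q, χ (((u + k : ℤ)) : ZMod q) *
          ((sinSum n (2 * π * ((u + k - u : ℤ) : ℝ) / q) -
            sinSum n (2 * π * ((u + k - (u + L) : ℤ) : ℝ) / q) : ℝ) : ℂ)
        + ∑ k ∈ range q, χ (((u + k : ℤ)) : ZMod q) *
          ((sawZ q ((u + k : ℤ) - u) - sinSum n (2 * π * (((u + k : ℤ) - u : ℤ) : ℝ) / q) : ℝ) : ℂ)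
        - ∑ k ∈ range q, χ (((u + k : ℤ)) : ZMod q) *
          ((sawZ q ((u + k : ℤ) - (u + L)) -
            sinSum n (2 * π * (((u + k : ℤ) - (u + L) : ℤ) : ℝ) / q) : ℝ) : ℂ) := by
    rw [← Finset.sum_add_distrib, ← Finset.sum_sub_distrib]
    refine Finset.sum_congr rfl fun k _ => ?_
    rw [hdec k]; simp only [hg]; ring
  have hM := norm_sum_char_mul_sinSum_sub_le hχ hodd n u u (u + L)
  have hT1 := norm_sum_char_mul_tail_le n χ u u
  have hT2 := norm_sum_char_mul_tail_le n χ u (u + L)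
  -- the identity `π S' = M + T₁ − T₂`
  have hS' : ‖g u / 2 + ∑ k ∈ Ico 1 L, g (u + k) + g (u + L) / 2‖ ≤
      (Real.sqrt q * (∑ m ∈ range n, 1 / ((m + 1 : ℕ) : ℝ) + (π + 1)) +
        2 * (1 / (n + 1 / 2) * ∑ r ∈ Ico 1 q, 1 / Real.sin (π * r / q))) / π := by
    rw [le_div_iff₀ hπ]
    have hnorm : ‖g u / 2 + ∑ k ∈ Ico 1 L, g (u + k) + g (u + L) / 2‖ * π =
        ‖(π : ℂ) * (g u / 2 + ∑ k ∈ Ico 1 L, g (u + k) + g (u + L) / 2)‖ := by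
      rw [norm_mul, Complex.norm_real, Real.norm_eq_abs, abs_of_pos hπ, mul_comm]
    rw [hnorm, ← hid, hsum]
    refine (norm_sub_le _ _).trans ?_
    refine (add_le_add (norm_add_le _ _) le_rfl).trans ?_
    linarith
  -- remove the two half end-points
  have hends : ∑ k ∈ Ico 1 L, χ (((u + k : ℤ)) : ZMod q) =
      (g u / 2 + ∑ k ∈ Ico 1 L, g (u + k) + g (u + L) / 2) - g u / 2 - g (u + L) / 2 := by
    simp only [hg]; ring
  rw [hends]
  have h1 : ‖g u / 2‖ ≤ 1 / 2 := by
    simp only [hg]; rw [norm_div, Complex.norm_two]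
    linarith [χ.norm_le_one ((u : ℤ) : ZMod q)]
  have h2 : ‖g (u + L) / 2‖ ≤ 1 / 2 := by
    simp only [hg]; rw [norm_div, Complex.norm_two]
    linarith [χ.norm_le_one ((u + L : ℤ) : ZMod q)]
  calc ‖(g u / 2 + ∑ k ∈ Ico 1 L, g (u + k) + g (u + L) / 2) - g u / 2 - g (u + L) / 2‖
      ≤ ‖(g u / 2 + ∑ k ∈ Ico 1 L, g (u + k) + g (u + L) / 2) - g u / 2‖ + ‖g (u + L) / 2‖ :=
        norm_sub_le _ _
    _ ≤ ‖g u / 2 + ∑ k ∈ Ico 1 L, g (u + k) + g (u + L) / 2‖ + ‖g u / 2‖ + ‖g (u + L) / 2‖ :=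
        add_le_add (norm_sub_le _ _) le_rfl
    _ ≤ _ := by linarith

omit [NeZero q] in
/-- **Numerics of the truncation** ([Pomerance2011] §4 takes `n = ⌊(4/π)√q log q⌋`; here
`n = ⌊2√q log q⌋ + 1`, `H_n ≤ 1 + log n`, Landau's cosecant sum
`Σ_{0<r<q} csc(πr/q) ≤ (2/π) q log q + (2/5) q` (`Literature.Analysis.Quadrature.sum_inv_sin_le`), and
`(2 + log 3 + π)/π + 2/π² + 2/(5π) ≤ 5/2`): for `q ≥ 3` the raw block bound is at most
`√q log q/(2π) + √q log log q/π + (5/2)√q + 1`. [folklore] -/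
private theorem block_bound_numerics (hq : 3 ≤ q) :
    1 + (Real.sqrt q * (∑ m ∈ range (⌊2 * Real.sqrt q * Real.log q⌋₊ + 1), 1 / ((m + 1 : ℕ) : ℝ)
        + (π + 1)) +
      2 * (1 / ((⌊2 * Real.sqrt q * Real.log q⌋₊ + 1 : ℕ) + 1 / 2) *
        ∑ r ∈ Ico 1 q, 1 / Real.sin (π * r / q))) / π ≤
      Real.sqrt q * Real.log q / (2 * π) + Real.sqrt q * Real.log (Real.log q) / π +
        5 / 2 * Real.sqrt q + 1 := by
  have hπ := Real.pi_pos
  have hπ3 := Real.pi_gt_d2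
  have hqR : (3 : ℝ) ≤ q := by exact_mod_cast hq
  have hq0 : (0 : ℝ) < q := by linarith
  have hsq : 0 < Real.sqrt q := Real.sqrt_pos.mpr hq0
  have hsq1 : 1 ≤ Real.sqrt q := by
    rw [show (1 : ℝ) = Real.sqrt 1 from Real.sqrt_one.symm]
    exact Real.sqrt_le_sqrt (by linarith)
  -- `log q ≥ 1`
  have hlog1 : 1 ≤ Real.log q := by
    rw [Real.le_log_iff_exp_le hq0]
    have := Real.exp_one_lt_d9
    linarith
  have hlog0 : 0 < Real.log q := by linarith
  set A : ℝ := Real.sqrt q * Real.log q with hA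
  have hA1 : 1 ≤ A := by rw [hA]; nlinarith
  have hA0 : 0 < A := by linarith
  set n : ℕ := ⌊2 * Real.sqrt q * Real.log q⌋₊ + 1 with hn
  have hn2A : 2 * A < n := by
    rw [hn, hA]; push_cast
    have := Nat.lt_floor_add_one (2 * Real.sqrt q * Real.log q)
    linarith
  have hnle : (n : ℝ) ≤ 3 * A := by
    rw [hn, hA]; push_cast
    have := Nat.floor_le (by positivity : (0 : ℝ) ≤ 2 * Real.sqrt q * Real.log q)
    nlinarith
  have hn0 : (0 : ℝ) < n := by linarith
  -- harmonic number
  have hH : ∑ m ∈ range n, 1 / ((m + 1 : ℕ) : ℝ) ≤ 1 + Real.log n := by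
    have h := harmonic_le_one_add_log n
    have : ((harmonic n : ℚ) : ℝ) = ∑ m ∈ range n, 1 / ((m + 1 : ℕ) : ℝ) := by
      simp [harmonic, one_div]
    rw [← this]; exact h
  have hlogn : Real.log n ≤ Real.log 3 + Real.log q / 2 + Real.log (Real.log q) := by
    calc Real.log n ≤ Real.log (3 * A) := Real.log_le_log hn0 hnle
      _ = Real.log 3 + Real.log (Real.sqrt q) + Real.log (Real.log q) := by
          rw [hA, Real.log_mul (by norm_num) (by positivity), Real.log_mul hsq.ne' hlog0.ne']
          ring
      _ = _ := by rw [Real.log_sqrt hq0.le]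
  have hlog3 : Real.log 3 ≤ 1.3863 := by
    have h4 : Real.log 3 ≤ Real.log 4 := Real.log_le_log (by norm_num) (by norm_num)
    have : Real.log 4 = 2 * Real.log 2 := by
      rw [show (4 : ℝ) = 2 ^ 2 by norm_num, Real.log_pow]; norm_num
    have := Real.log_two_lt_d9
    linarith
  -- cosecant sum
  have hcsc : ∑ r ∈ Ico 1 q, 1 / Real.sin (π * r / q) ≤ 2 / π * q * Real.log q + 2 / 5 * q :=
    Literature.Analysis.Quadrature.sum_inv_sin_le (by omega)
  have hcsc0 : 0 ≤ 2 / π * q * Real.log q + 2 / 5 * q := by positivity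
  have hT : 1 / ((n : ℝ) + 1 / 2) * ∑ r ∈ Ico 1 q, 1 / Real.sin (π * r / q) ≤
      Real.sqrt q * π⁻¹ + Real.sqrt q / 5 := by
    have hinv : 1 / ((n : ℝ) + 1 / 2) ≤ 1 / (2 * A) :=
      one_div_le_one_div_of_le (by positivity) (by linarith)
    calc 1 / ((n : ℝ) + 1 / 2) * ∑ r ∈ Ico 1 q, 1 / Real.sin (π * r / q)
        ≤ 1 / (2 * A) * (2 / π * q * Real.log q + 2 / 5 * q) :=
          mul_le_mul hinv hcsc (by
            refine Finset.sum_nonneg fun r hr => ?_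
            rw [Finset.mem_Ico] at hr
            have hr0 : (0 : ℝ) < r := by exact_mod_cast hr.1
            have hrq : (r : ℝ) < q := by exact_mod_cast hr.2
            have : 0 < Real.sin (π * r / q) := by
              refine Real.sin_pos_of_pos_of_lt_pi (by positivity) ?_
              rw [div_lt_iff₀ hq0]; nlinarith
            positivity) (by positivity)
      _ = Real.sqrt q / π + Real.sqrt q / (5 * Real.log q) := by
          rw [hA]
          have hsq2 : Real.sqrt q * Real.sqrt q = q := Real.mul_self_sqrt hq0.le
          field_simp
          nlinarith [hsq2]
      _ ≤ Real.sqrt q * π⁻¹ + Real.sqrt q / 5 := by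
          rw [← div_eq_mul_inv]
          have : Real.sqrt q / (5 * Real.log q) ≤ Real.sqrt q / 5 :=
            div_le_div_of_nonneg_left hsq.le (by norm_num) (by nlinarith)
          linarith
  -- the constant: `(2 + log 3 + π) + 2/π + 2/5 ≤ (5/2) π`
  have hconst : 2 + Real.log 3 + π + 2 * π⁻¹ + 2 / 5 ≤ 5 / 2 * π := by
    have h2π : π⁻¹ ≤ (3.14 : ℝ)⁻¹ := inv_anti₀ (by norm_num) hπ3.le
    have h314 : (3.14 : ℝ)⁻¹ ≤ 0.3185 := by norm_num
    linarith
  -- assemble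
  have hmain : Real.sqrt q * (∑ m ∈ range n, 1 / ((m + 1 : ℕ) : ℝ) + (π + 1)) ≤
      Real.sqrt q * (2 + Real.log 3 + Real.log q / 2 + Real.log (Real.log q) + π) := by
    refine mul_le_mul_of_nonneg_left ?_ hsq.le
    linarith
  have key : Real.sqrt q * (∑ m ∈ range n, 1 / ((m + 1 : ℕ) : ℝ) + (π + 1)) +
      2 * (1 / ((n : ℝ) + 1 / 2) * ∑ r ∈ Ico 1 q, 1 / Real.sin (π * r / q)) ≤
      A / 2 + Real.sqrt q * Real.log (Real.log q) + 5 / 2 * Real.sqrt q * π := by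
    have hprod := mul_le_mul_of_nonneg_left hconst hsq.le
    have hAq : Real.sqrt q * (Real.log q / 2) = A / 2 := by rw [hA]; ring
    linarith [hmain, hT, hprod, hAq]
  have hfin : (Real.sqrt q * (∑ m ∈ range n, 1 / ((m + 1 : ℕ) : ℝ) + (π + 1)) +
      2 * (1 / ((n : ℝ) + 1 / 2) * ∑ r ∈ Ico 1 q, 1 / Real.sin (π * r / q))) / π ≤
      A / (2 * π) + Real.sqrt q * Real.log (Real.log q) / π + 5 / 2 * Real.sqrt q := by
    rw [div_le_iff₀ hπ]
    have : (A / (2 * π) + Real.sqrt q * Real.log (Real.log q) / π + 5 / 2 * Real.sqrt q) * π =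
        A / 2 + Real.sqrt q * Real.log (Real.log q) + 5 / 2 * Real.sqrt q * π := by
      field_simp
    rw [this]; exact key
  have hcast : ((⌊2 * Real.sqrt q * Real.log q⌋₊ + 1 : ℕ) : ℝ) = (n : ℝ) := by rw [hn]
  rw [hcast]
  linarith


/-- **The block bound**: for `χ` primitive and odd mod `q`, an integer `u` and `1 ≤ L ≤ q`,
`|Σ_{0<k<L} χ(u + k)| ≤ √q log q/(2π) + √q log log q/π + (5/2)√q + 1`.
[cite: Pomerance2011, Theorem 1 (odd case), §4 (11)] -/
theorem norm_sum_char_block_le {χ : DirichletCharacter ℂ q} (hχ : χ.IsPrimitive) (hodd : χ.Odd)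
    (u : ℤ) {L : ℕ} (hL1 : 1 ≤ L) (hLq : L ≤ q) :
    ‖∑ k ∈ Ico 1 L, χ (((u + k : ℤ)) : ZMod q)‖ ≤
      Real.sqrt q * Real.log q / (2 * π) + Real.sqrt q * Real.log (Real.log q) / π +
        5 / 2 * Real.sqrt q + 1 :=
  (norm_sum_char_block_le_raw hχ hodd u hL1 hLq _).trans (block_bound_numerics (three_le_of_odd hodd))

omit [NeZero q] in
/-- An integer interval `[b, b + r)` as a shifted range. [folklore] -/
private theorem sum_Ico_int_eq_sum_range {M : Type*} [AddCommMonoid M] (f : ℤ → M) (b : ℤ) (r : ℕ) :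
    ∑ j ∈ Ico b (b + r), f j = ∑ k ∈ range r, f (b + k) := by
  refine (Finset.sum_nbij' (fun k : ℕ => b + k) (fun j : ℤ => (j - b).toNat) ?_ ?_ ?_ ?_
    (fun _ _ => rfl)).symm
  · intro k hk; rw [mem_range] at hk; rw [mem_Ico]; omega
  · intro j hj; rw [mem_Ico] at hj; rw [mem_range]; omega
  · intro k _; simp
  · intro j hj; rw [mem_Ico] at hj; omega

/-- A non-principal character sums to zero over `q t` consecutive integers. [folklore] -/
private theorem sum_char_Ico_period_mul_eq_zero {χ : DirichletCharacter ℂ q} (hχ1 : χ ≠ 1) (a : ℤ) (t : ℕ) :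
    ∑ j ∈ Ico a (a + (q * t : ℕ)), χ ((j : ZMod q)) = 0 := by
  induction t with
  | zero => simp
  | succ t ih =>
    have hsplit : Ico a (a + (q * (t + 1) : ℕ)) = Ico a (a + (q * t : ℕ)) ∪
        Ico (a + (q * t : ℕ)) (a + (q * t : ℕ) + q) := by
      rw [Finset.Ico_union_Ico_eq_Ico (le_add_of_nonneg_right (by positivity))
        (le_add_of_nonneg_right (by positivity)), Nat.mul_succ]; push_cast; ring_nf
    rw [hsplit, Finset.sum_union (Finset.Ico_disjoint_Ico_consecutive _ _ _), ih, zero_add,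
      sum_Ico_int_eq_sum_range]
    exact sum_char_shift_eq_zero hχ1 _

/-- **Pólya–Vinogradov for odd primitive characters, integer intervals** (Landau 1918 with the
constant `1/(2π)`; [Pomerance2011] Theorem 1, odd case, with explicit secondary terms in place of the
finite check of small moduli): for `χ` primitive mod `q` with `χ(−1) = −1`, every integer `a` and
every `N`, `|Σ_{a ≤ j < a+N} χ(j)| ≤ √q log q/(2π) + √q log log q/π + (5/2)√q + 1`.
[cite: Pomerance2011, Theorem 1 and §4 (11)] -/
theorem polyaVinogradov_odd_int {χ : DirichletCharacter ℂ q} (hχ : χ.IsPrimitive) (hodd : χ.Odd)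
    (a : ℤ) (N : ℕ) :
    ‖∑ j ∈ Ico a (a + N), χ ((j : ZMod q))‖ ≤
      Real.sqrt q * Real.log q / (2 * π) + Real.sqrt q * Real.log (Real.log q) / π +
        5 / 2 * Real.sqrt q + 1 := by
  have hq : 0 < q := Nat.pos_of_ne_zero (NeZero.ne q)
  -- remove the full periods
  set t : ℕ := N / q with ht
  set r : ℕ := N % q with hr
  have hrq : r < q := Nat.mod_lt N hq
  have hN : (N : ℤ) = ((q * t : ℕ) : ℤ) + (r : ℤ) := by
    rw [ht, hr]; exact_mod_cast (Nat.div_add_mod N q).symm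
  have hsplit : Ico a (a + N) = Ico a (a + (q * t : ℕ)) ∪ Ico (a + (q * t : ℕ)) (a + (q * t : ℕ) + r) := by
    rw [Finset.Ico_union_Ico_eq_Ico (le_add_of_nonneg_right (by positivity))
      (le_add_of_nonneg_right (by positivity)), hN, add_assoc]
  rw [hsplit, Finset.sum_union (Finset.Ico_disjoint_Ico_consecutive _ _ _),
    sum_char_Ico_period_mul_eq_zero (ne_one_of_odd hodd), zero_add, sum_Ico_int_eq_sum_range]
  -- the last `r < q` terms are a block `u + k`, `0 < k < r + 1`, `u = a + qt − 1`
  set b : ℤ := a + (q * t : ℕ) with hb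
  have hblock : ∑ k ∈ range r, χ (((b + k : ℤ)) : ZMod q) =
      ∑ k ∈ Ico 1 (r + 1), χ ((((b - 1) + k : ℤ)) : ZMod q) := by
    rw [Finset.sum_Ico_eq_sum_range, Nat.add_sub_cancel]
    refine Finset.sum_congr rfl fun k _ => ?_
    congr 1; push_cast; ring
  rw [hblock]
  exact norm_sum_char_block_le hχ hodd (b - 1) (by omega) (by omega)

omit [NeZero q] in
/-- `(A, A + N] ⊆ ℕ` as the integer interval `[A + 1, A + 1 + N)`. [folklore] -/
private theorem sum_Ioc_nat_eq_sum_Ico_int {M : Type*} [AddCommMonoid M] (f : ℤ → M) (A N : ℕ) :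
    ∑ n ∈ Ioc A (A + N), f n = ∑ j ∈ Ico ((A : ℤ) + 1) ((A : ℤ) + 1 + N), f j := by
  refine Finset.sum_nbij' (fun n : ℕ => (n : ℤ)) (fun m : ℤ => m.toNat) ?_ ?_ ?_ ?_ (fun _ _ => rfl)
  · intro n hn; rw [mem_Ioc] at hn; rw [mem_Ico]; omega
  · intro m hm; rw [mem_Ico] at hm; rw [mem_Ioc]; omega
  · intro n _; simp
  · intro m hm; rw [mem_Ico] at hm; omega

omit [NeZero q] in
/-- `[M, N] ⊆ ℕ` as the integer interval `[M, N + 1)`. [folklore] -/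
private theorem sum_Icc_nat_eq_sum_Ico_int {A : Type*} [AddCommMonoid A] (f : ℤ → A) (M N : ℕ) :
    ∑ n ∈ Icc M N, f n = ∑ j ∈ Ico (M : ℤ) ((M : ℤ) + (N + 1 - M : ℕ)), f j := by
  refine Finset.sum_nbij' (fun n : ℕ => (n : ℤ)) (fun m : ℤ => m.toNat) ?_ ?_ ?_ ?_ (fun _ _ => rfl)
  · intro n hn; rw [mem_Icc] at hn; rw [mem_Ico]; omega
  · intro m hm; rw [mem_Ico] at hm; rw [mem_Icc]; omega
  · intro n _; simp
  · intro m hm; rw [mem_Ico] at hm; omega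

end Sawtooth

open Sawtooth in
/-- **The Pólya–Vinogradov inequality for odd primitive characters with Landau's constant `1/(2π)`**
(Landau 1918; [Pomerance2011] Theorem 1, odd case: `S(χ) ≤ (1/(2π))√q log q + (1/π)√q log log q +
√q`, there with the secondary terms absorbed by a finite check of `q < 45`; here kernel-proved for
all `q` with explicit secondary terms): for `χ` primitive mod `q` with `χ(−1) = −1` and every
interval `(A, A + N]`,
`|Σ_{A<n≤A+N} χ(n)| ≤ √q log q/(2π) + √q log log q/π + (5/2)√q + 1`.
Compare the tree's `polyaVinogradov` (`√q (1 + log q)`), `polyaVinogradov_two_div_pi`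
(`(2/π)√q log q + (2/5)√q`) and the named fact `frolenkovSoundararajan2013_pv` (Frolenkov–Soundararajan's
`1/(2π)` / `2/π²` with smaller secondary terms, not proved in the tree).
[cite: Pomerance2011, Theorem 1 (odd case) and §4 (11)] -/
theorem polyaVinogradov_odd {q : ℕ} [NeZero q] {χ : DirichletCharacter ℂ q} (hχ : χ.IsPrimitive)
    (hodd : χ.Odd) (A N : ℕ) :
    ‖∑ n ∈ Ioc A (A + N), χ n‖ ≤
      Real.sqrt q * Real.log q / (2 * π) + Real.sqrt q * Real.log (Real.log q) / π +
        5 / 2 * Real.sqrt q + 1 := by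
  have h := sum_Ioc_nat_eq_sum_Ico_int (fun j : ℤ => χ ((j : ZMod q))) A N
  simp only [Int.cast_natCast] at h
  rw [h]
  exact polyaVinogradov_odd_int hχ hodd _ _

open Sawtooth in
/-- The same for closed intervals `[M, N] ⊆ ℕ`. [cite: Pomerance2011, Theorem 1 (odd case)] -/
theorem polyaVinogradov_odd_Icc {q : ℕ} [NeZero q] {χ : DirichletCharacter ℂ q}
    (hχ : χ.IsPrimitive) (hodd : χ.Odd) (M N : ℕ) :
    ‖∑ n ∈ Icc M N, χ n‖ ≤
      Real.sqrt q * Real.log q / (2 * π) + Real.sqrt q * Real.log (Real.log q) / π +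
        5 / 2 * Real.sqrt q + 1 := by
  have h := sum_Icc_nat_eq_sum_Ico_int (fun j : ℤ => χ ((j : ZMod q))) M N
  simp only [Int.cast_natCast] at h
  rw [h]
  exact polyaVinogradov_odd_int hχ hodd _ _

/-! ### All primitive characters: Landau's constant `1/π`

The same machinery without the parity input: for ANY primitive `χ` mod `q` the Gauss-sum step gives
`|Σ_{k mod q} χ(k) sin(2πm(k − w)/q)| ≤ √q` ([Pomerance2011] §2 (7) with `e(x) = cos 2πx + i sin 2πx`), so
the main term is at most `(2√q/π) H_n` (no cancellation between the two end-points is used, `|sin| ≤ 1`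
termwise), which is Landau's leading constant `1/π` of [Pomerance2011] §1 (2) — half the tree's
`polyaVinogradov_two_div_pi`. (Landau's `1/(√2 π)` and Bateman–Pomerance's `2/π²` for even characters need
the mean value `2/π` of `|sin|`, [Pomerance2011] Lemma 3, not done here.) -/

namespace Sawtooth

variable {q : ℕ} [NeZero q]

/-- A primitive character modulo `q ≥ 2` is not principal (the principal character has conductor `1`).
[folklore] -/
private theorem ne_one_of_isPrimitive {χ : DirichletCharacter ℂ q} (hχ : χ.IsPrimitive) (hq : 2 ≤ q) :
    χ ≠ 1 := by
  rintro rfl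
  rw [DirichletCharacter.isPrimitive_def, DirichletCharacter.conductor_one] at hχ
  omega

/-- **Primitive characters against sines, any parity**: `|Σ_{k<q} χ(u + k) sin(2π m (u + k − w)/q)| ≤ √q`
(from `Σ_k χ(k) e(±mk/q) = τ(χ) χ̄(±m)`, [Pomerance2011] §2 (7), and `|τ(χ)| = √q`).
[cite: Pomerance2011, §2 (7)] -/
theorem norm_sum_char_shift_mul_sin_le {χ : DirichletCharacter ℂ q} (hχ : χ.IsPrimitive) (u w m : ℤ) :
    ‖∑ k ∈ range q, χ (((u + k : ℤ)) : ZMod q) *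
        ((Real.sin (2 * π * ((m : ℝ) * ((u + k - w : ℤ) : ℝ) / q)) : ℝ) : ℂ)‖ ≤ Real.sqrt q := by
  have hτ := sum_char_shift_mul_e hχ u m
  have hτ' := sum_char_shift_mul_e hχ u (-m)
  have hterm : ∀ k : ℕ, χ (((u + k : ℤ)) : ZMod q) *
      ((Real.sin (2 * π * ((m : ℝ) * ((u + k - w : ℤ) : ℝ) / q)) : ℝ) : ℂ) =
      χ (((u + k : ℤ)) : ZMod q) * e (((-m : ℤ) : ℝ) * ((u + k : ℤ) : ℝ) / q) *
          (e ((m : ℝ) * (w : ℝ) / q) * Complex.I / 2) -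
        χ (((u + k : ℤ)) : ZMod q) * e ((m : ℝ) * ((u + k : ℤ) : ℝ) / q) *
          (e (-((m : ℝ) * (w : ℝ) / q)) * Complex.I / 2) := by
    intro k
    rw [ofReal_sin_two_pi_mul]
    have e1 : e (-((m : ℝ) * ((u + k - w : ℤ) : ℝ) / q)) =
        e (((-m : ℤ) : ℝ) * ((u + k : ℤ) : ℝ) / q) * e ((m : ℝ) * (w : ℝ) / q) := by
      rw [← e_add]; congr 1; push_cast; ring
    have e2 : e ((m : ℝ) * ((u + k - w : ℤ) : ℝ) / q) =
        e ((m : ℝ) * ((u + k : ℤ) : ℝ) / q) * e (-((m : ℝ) * (w : ℝ) / q)) := by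
      rw [← e_add]; congr 1; push_cast; ring
    rw [e1, e2]; ring
  rw [Finset.sum_congr rfl fun k _ => hterm k, Finset.sum_sub_distrib, ← Finset.sum_mul,
    ← Finset.sum_mul, hτ, hτ']
  have hg := norm_gaussSum_eq_sqrt hχ
  have h1 : ‖gaussSum χ ZMod.stdAddChar * χ⁻¹ ((-m : ℤ) : ZMod q) *
      (e ((m : ℝ) * (w : ℝ) / q) * Complex.I / 2)‖ ≤ Real.sqrt q / 2 := by
    rw [norm_mul, norm_mul, norm_div, norm_mul, norm_e, Complex.norm_I, Complex.norm_two, hg]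
    have := χ⁻¹.norm_le_one ((-m : ℤ) : ZMod q)
    have h0 : 0 ≤ Real.sqrt q := Real.sqrt_nonneg _
    nlinarith
  have h2 : ‖gaussSum χ ZMod.stdAddChar * χ⁻¹ (m : ZMod q) *
      (e (-((m : ℝ) * (w : ℝ) / q)) * Complex.I / 2)‖ ≤ Real.sqrt q / 2 := by
    rw [norm_mul, norm_mul, norm_div, norm_mul, norm_e, Complex.norm_I, Complex.norm_two, hg]
    have := χ⁻¹.norm_le_one ((m : ℤ) : ZMod q)
    have h0 : 0 ≤ Real.sqrt q := Real.sqrt_nonneg _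
    nlinarith
  calc _ ≤ ‖gaussSum χ ZMod.stdAddChar * χ⁻¹ ((-m : ℤ) : ZMod q) *
          (e ((m : ℝ) * (w : ℝ) / q) * Complex.I / 2)‖ +
        ‖gaussSum χ ZMod.stdAddChar * χ⁻¹ (m : ZMod q) *
          (e (-((m : ℝ) * (w : ℝ) / q)) * Complex.I / 2)‖ := norm_sub_le _ _
    _ ≤ Real.sqrt q / 2 + Real.sqrt q / 2 := add_le_add h1 h2
    _ = Real.sqrt q := by ring

/-- **The main term, any parity**: `|Σ_{k<q} χ(u + k) P_n(2π(u + k − w)/q)| ≤ √q H_n` for `χ` primitive.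
[cite: Pomerance2011, §2 (7)] -/
theorem norm_sum_char_shift_mul_sinSum_le {χ : DirichletCharacter ℂ q} (hχ : χ.IsPrimitive)
    (n : ℕ) (u w : ℤ) :
    ‖∑ k ∈ range q, χ (((u + k : ℤ)) : ZMod q) *
        ((sinSum n (2 * π * ((u + k - w : ℤ) : ℝ) / q) : ℝ) : ℂ)‖ ≤
      Real.sqrt q * ∑ m ∈ range n, 1 / ((m + 1 : ℕ) : ℝ) := by
  have hexp : ∀ k : ℕ, ((sinSum n (2 * π * ((u + k - w : ℤ) : ℝ) / q) : ℝ) : ℂ) =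
      ∑ m ∈ range n, ((Real.sin (2 * π * ((((m + 1 : ℕ) : ℤ) : ℝ) * ((u + k - w : ℤ) : ℝ) / q))
        : ℝ) : ℂ) / ((m + 1 : ℕ) : ℂ) := by
    intro k
    unfold sinSum
    rw [Complex.ofReal_sum]
    refine Finset.sum_congr rfl fun m _ => ?_
    have : ((m + 1 : ℕ) : ℝ) * (2 * π * ((u + k - w : ℤ) : ℝ) / q) =
        2 * π * ((((m + 1 : ℕ) : ℤ) : ℝ) * ((u + k - w : ℤ) : ℝ) / q) := by push_cast; ring
    rw [this, Complex.ofReal_div, Complex.ofReal_natCast]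
  simp_rw [hexp, Finset.mul_sum]
  rw [Finset.sum_comm]
  refine (norm_sum_le _ _).trans (Finset.sum_le_sum fun m _ => ?_)
  have h := norm_sum_char_shift_mul_sin_le hχ u w ((m + 1 : ℕ) : ℤ)
  have hm : (0 : ℝ) < ((m + 1 : ℕ) : ℝ) := by positivity
  have : ∑ k ∈ range q, χ (((u + k : ℤ)) : ZMod q) *
      (((Real.sin (2 * π * ((((m + 1 : ℕ) : ℤ) : ℝ) * ((u + k - w : ℤ) : ℝ) / q)) : ℝ) : ℂ) /
        ((m + 1 : ℕ) : ℂ)) =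
      (∑ k ∈ range q, χ (((u + k : ℤ)) : ZMod q) *
        ((Real.sin (2 * π * ((((m + 1 : ℕ) : ℤ) : ℝ) * ((u + k - w : ℤ) : ℝ) / q)) : ℝ) : ℂ)) /
        ((m + 1 : ℕ) : ℂ) := by
    rw [Finset.sum_div]
    exact Finset.sum_congr rfl fun k _ => by ring
  rw [this, norm_div, Complex.norm_natCast, div_le_iff₀ hm]
  calc _ ≤ Real.sqrt q := h
    _ = Real.sqrt q * (1 / ((m + 1 : ℕ) : ℝ)) * ((m + 1 : ℕ) : ℝ) := by field_simp

/-- **One block, any parity, truncation `n` free**: for `χ` primitive mod `q ≥ 2`, an integer `u` and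
`1 ≤ L ≤ q`, `|Σ_{0<k<L} χ(u+k)| ≤ 1 + (2√q H_n + (2/(n+½)) Σ_{0<r<q} csc(πr/q))/π`.
[cite: Pomerance2011, §1 (2), §2 Lemma 4] -/
theorem norm_sum_char_block_le_raw' {χ : DirichletCharacter ℂ q} (hχ : χ.IsPrimitive) (hq : 2 ≤ q)
    (u : ℤ) {L : ℕ} (hL1 : 1 ≤ L) (hLq : L ≤ q) (n : ℕ) :
    ‖∑ k ∈ Ico 1 L, χ (((u + k : ℤ)) : ZMod q)‖ ≤
      1 + (2 * (Real.sqrt q * ∑ m ∈ range n, 1 / ((m + 1 : ℕ) : ℝ)) +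
        2 * (1 / (n + 1 / 2) * ∑ r ∈ Ico 1 q, 1 / Real.sin (π * r / q))) / π := by
  have hπ := Real.pi_pos
  set g : ℤ → ℂ := fun z => χ ((z : ZMod q)) with hg
  have hper : L = q → g (u + q) = g u := by
    intro _; simp only [hg]; push_cast; rw [ZMod.natCast_self, add_zero]
  have hid := sum_mul_sawZ_sub_sawZ g u hL1 hLq hper
  have hzero : ∑ k ∈ range q, g (u + k) = 0 := sum_char_shift_eq_zero (ne_one_of_isPrimitive hχ hq) u
  rw [hzero, mul_zero, sub_zero] at hid
  have hdec : ∀ k : ℕ, ((sawZ q k - sawZ q ((k : ℤ) - L) : ℝ) : ℂ) =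
      ((sinSum n (2 * π * ((u + k - u : ℤ) : ℝ) / q) : ℝ) : ℂ)
      - ((sinSum n (2 * π * ((u + k - (u + L) : ℤ) : ℝ) / q) : ℝ) : ℂ)
      + ((sawZ q ((u + k : ℤ) - u) - sinSum n (2 * π * (((u + k : ℤ) - u : ℤ) : ℝ) / q) : ℝ) : ℂ)
      - ((sawZ q ((u + k : ℤ) - (u + L)) -
          sinSum n (2 * π * (((u + k : ℤ) - (u + L) : ℤ) : ℝ) / q) : ℝ) : ℂ) := by
    intro k
    have e1 : sawZ q k = sawZ q ((u + k : ℤ) - u) := by congr 1; ring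
    have e2 : sawZ q ((k : ℤ) - L) = sawZ q ((u + k : ℤ) - (u + L)) := by congr 1; ring
    rw [e1, e2]; push_cast; ring
  have hsum : ∑ k ∈ range q, g (u + k) * ((sawZ q k - sawZ q ((k : ℤ) - L) : ℝ) : ℂ) =
      ∑ k ∈ range q, χ (((u + k : ℤ)) : ZMod q) *
          ((sinSum n (2 * π * ((u + k - u : ℤ) : ℝ) / q) : ℝ) : ℂ)
        - ∑ k ∈ range q, χ (((u + k : ℤ)) : ZMod q) *
          ((sinSum n (2 * π * ((u + k - (u + L) : ℤ) : ℝ) / q) : ℝ) : ℂ)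
        + ∑ k ∈ range q, χ (((u + k : ℤ)) : ZMod q) *
          ((sawZ q ((u + k : ℤ) - u) - sinSum n (2 * π * (((u + k : ℤ) - u : ℤ) : ℝ) / q) : ℝ) : ℂ)
        - ∑ k ∈ range q, χ (((u + k : ℤ)) : ZMod q) *
          ((sawZ q ((u + k : ℤ) - (u + L)) -
            sinSum n (2 * π * (((u + k : ℤ) - (u + L) : ℤ) : ℝ) / q) : ℝ) : ℂ) := by
    rw [← Finset.sum_sub_distrib, ← Finset.sum_add_distrib, ← Finset.sum_sub_distrib]
    refine Finset.sum_congr rfl fun k _ => ?_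
    rw [hdec k]; simp only [hg]; ring
  have hM1 := norm_sum_char_shift_mul_sinSum_le hχ n u u
  have hM2 := norm_sum_char_shift_mul_sinSum_le hχ n u (u + L)
  have hT1 := norm_sum_char_mul_tail_le n χ u u
  have hT2 := norm_sum_char_mul_tail_le n χ u (u + L)
  have hS' : ‖g u / 2 + ∑ k ∈ Ico 1 L, g (u + k) + g (u + L) / 2‖ ≤
      (2 * (Real.sqrt q * ∑ m ∈ range n, 1 / ((m + 1 : ℕ) : ℝ)) +
        2 * (1 / (n + 1 / 2) * ∑ r ∈ Ico 1 q, 1 / Real.sin (π * r / q))) / π := by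
    rw [le_div_iff₀ hπ]
    have hnorm : ‖g u / 2 + ∑ k ∈ Ico 1 L, g (u + k) + g (u + L) / 2‖ * π =
        ‖(π : ℂ) * (g u / 2 + ∑ k ∈ Ico 1 L, g (u + k) + g (u + L) / 2)‖ := by
      rw [norm_mul, Complex.norm_real, Real.norm_eq_abs, abs_of_pos hπ, mul_comm]
    rw [hnorm, ← hid, hsum]
    refine (norm_sub_le _ _).trans ?_
    refine (add_le_add (norm_add_le _ _) le_rfl).trans ?_
    refine (add_le_add (add_le_add (norm_sub_le _ _) le_rfl) le_rfl).trans ?_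
    linarith
  have hends : ∑ k ∈ Ico 1 L, χ (((u + k : ℤ)) : ZMod q) =
      (g u / 2 + ∑ k ∈ Ico 1 L, g (u + k) + g (u + L) / 2) - g u / 2 - g (u + L) / 2 := by
    simp only [hg]; ring
  rw [hends]
  have h1 : ‖g u / 2‖ ≤ 1 / 2 := by
    simp only [hg]; rw [norm_div, Complex.norm_two]
    linarith [χ.norm_le_one ((u : ℤ) : ZMod q)]
  have h2 : ‖g (u + L) / 2‖ ≤ 1 / 2 := by
    simp only [hg]; rw [norm_div, Complex.norm_two]
    linarith [χ.norm_le_one ((u + L : ℤ) : ZMod q)]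
  calc ‖(g u / 2 + ∑ k ∈ Ico 1 L, g (u + k) + g (u + L) / 2) - g u / 2 - g (u + L) / 2‖
      ≤ ‖(g u / 2 + ∑ k ∈ Ico 1 L, g (u + k) + g (u + L) / 2) - g u / 2‖ + ‖g (u + L) / 2‖ :=
        norm_sub_le _ _
    _ ≤ ‖g u / 2 + ∑ k ∈ Ico 1 L, g (u + k) + g (u + L) / 2‖ + ‖g u / 2‖ + ‖g (u + L) / 2‖ :=
        add_le_add (norm_sub_le _ _) le_rfl
    _ ≤ _ := by linarith

omit [NeZero q] in
set_option maxHeartbeats 400000 in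
/-- Numerics for the parity-free block bound with `n = ⌊2√q log q⌋ + 1` (`q ≥ 3`):
`2(1 + log 3) + 2/π + 2/5 ≤ 2π`. [folklore] -/
private theorem block_bound_numerics' (hq : 3 ≤ q) :
    1 + (2 * (Real.sqrt q * ∑ m ∈ range (⌊2 * Real.sqrt q * Real.log q⌋₊ + 1), 1 / ((m + 1 : ℕ) : ℝ)) +
      2 * (1 / ((⌊2 * Real.sqrt q * Real.log q⌋₊ + 1 : ℕ) + 1 / 2) *
        ∑ r ∈ Ico 1 q, 1 / Real.sin (π * r / q))) / π ≤
      Real.sqrt q * Real.log q / π + 2 * Real.sqrt q * Real.log (Real.log q) / π +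
        2 * Real.sqrt q + 1 := by
  have hπ := Real.pi_pos
  have hπ3 := Real.pi_gt_d2
  have hqR : (3 : ℝ) ≤ q := by exact_mod_cast hq
  have hq0 : (0 : ℝ) < q := by linarith
  have hsq : 0 < Real.sqrt q := Real.sqrt_pos.mpr hq0
  have hsq1 : 1 ≤ Real.sqrt q := by
    rw [show (1 : ℝ) = Real.sqrt 1 from Real.sqrt_one.symm]
    exact Real.sqrt_le_sqrt (by linarith)
  have hlog1 : 1 ≤ Real.log q := by
    rw [Real.le_log_iff_exp_le hq0]
    have := Real.exp_one_lt_d9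
    linarith
  have hlog0 : 0 < Real.log q := by linarith
  set A : ℝ := Real.sqrt q * Real.log q with hA
  have hA1 : 1 ≤ A := by rw [hA]; nlinarith
  have hA0 : 0 < A := by linarith
  set n : ℕ := ⌊2 * Real.sqrt q * Real.log q⌋₊ + 1 with hn
  have hn2A : 2 * A < n := by
    rw [hn, hA]; push_cast
    have := Nat.lt_floor_add_one (2 * Real.sqrt q * Real.log q)
    linarith
  have hnle : (n : ℝ) ≤ 3 * A := by
    rw [hn, hA]; push_cast
    have := Nat.floor_le (by positivity : (0 : ℝ) ≤ 2 * Real.sqrt q * Real.log q)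
    nlinarith
  have hn0 : (0 : ℝ) < n := by linarith
  have hH : ∑ m ∈ range n, 1 / ((m + 1 : ℕ) : ℝ) ≤ 1 + Real.log n := by
    have h := harmonic_le_one_add_log n
    have : ((harmonic n : ℚ) : ℝ) = ∑ m ∈ range n, 1 / ((m + 1 : ℕ) : ℝ) := by
      simp [harmonic, one_div]
    rw [← this]; exact h
  have hlogn : Real.log n ≤ Real.log 3 + Real.log q / 2 + Real.log (Real.log q) := by
    calc Real.log n ≤ Real.log (3 * A) := Real.log_le_log hn0 hnle
      _ = Real.log 3 + Real.log (Real.sqrt q) + Real.log (Real.log q) := by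
          rw [hA, Real.log_mul (by norm_num) (by positivity), Real.log_mul hsq.ne' hlog0.ne']
          ring
      _ = _ := by rw [Real.log_sqrt hq0.le]
  have hlog3 : Real.log 3 ≤ 1.3863 := by
    have h4 : Real.log 3 ≤ Real.log 4 := Real.log_le_log (by norm_num) (by norm_num)
    have : Real.log 4 = 2 * Real.log 2 := by
      rw [show (4 : ℝ) = 2 ^ 2 by norm_num, Real.log_pow]; norm_num
    have := Real.log_two_lt_d9
    linarith
  have hcsc : ∑ r ∈ Ico 1 q, 1 / Real.sin (π * r / q) ≤ 2 / π * q * Real.log q + 2 / 5 * q :=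
    Literature.Analysis.Quadrature.sum_inv_sin_le (by omega)
  have hT : 1 / ((n : ℝ) + 1 / 2) * ∑ r ∈ Ico 1 q, 1 / Real.sin (π * r / q) ≤
      Real.sqrt q * π⁻¹ + Real.sqrt q / 5 := by
    have hinv : 1 / ((n : ℝ) + 1 / 2) ≤ 1 / (2 * A) :=
      one_div_le_one_div_of_le (by positivity) (by linarith)
    calc 1 / ((n : ℝ) + 1 / 2) * ∑ r ∈ Ico 1 q, 1 / Real.sin (π * r / q)
        ≤ 1 / (2 * A) * (2 / π * q * Real.log q + 2 / 5 * q) :=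
          mul_le_mul hinv hcsc (by
            refine Finset.sum_nonneg fun r hr => ?_
            rw [Finset.mem_Ico] at hr
            have hr0 : (0 : ℝ) < r := by exact_mod_cast hr.1
            have hrq : (r : ℝ) < q := by exact_mod_cast hr.2
            have : 0 < Real.sin (π * r / q) := by
              refine Real.sin_pos_of_pos_of_lt_pi (by positivity) ?_
              rw [div_lt_iff₀ hq0]; nlinarith
            positivity) (by positivity)
      _ = Real.sqrt q / π + Real.sqrt q / (5 * Real.log q) := by
          rw [hA]
          have hsq2 : Real.sqrt q * Real.sqrt q = q := Real.mul_self_sqrt hq0.le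
          field_simp
          nlinarith [hsq2]
      _ ≤ Real.sqrt q * π⁻¹ + Real.sqrt q / 5 := by
          rw [← div_eq_mul_inv]
          have : Real.sqrt q / (5 * Real.log q) ≤ Real.sqrt q / 5 :=
            div_le_div_of_nonneg_left hsq.le (by norm_num) (by nlinarith)
          linarith
  have hconst : 2 * (1 + Real.log 3) + 2 * π⁻¹ + 2 / 5 ≤ 2 * π := by
    have h2π : π⁻¹ ≤ (3.14 : ℝ)⁻¹ := inv_anti₀ (by norm_num) hπ3.le
    have h314 : (3.14 : ℝ)⁻¹ ≤ 0.3185 := by norm_num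
    linarith
  have hmain : Real.sqrt q * ∑ m ∈ range n, 1 / ((m + 1 : ℕ) : ℝ) ≤
      Real.sqrt q * (1 + Real.log 3 + Real.log q / 2 + Real.log (Real.log q)) := by
    refine mul_le_mul_of_nonneg_left ?_ hsq.le
    linarith
  have key : 2 * (Real.sqrt q * ∑ m ∈ range n, 1 / ((m + 1 : ℕ) : ℝ)) +
      2 * (1 / ((n : ℝ) + 1 / 2) * ∑ r ∈ Ico 1 q, 1 / Real.sin (π * r / q)) ≤
      A + 2 * Real.sqrt q * Real.log (Real.log q) + 2 * Real.sqrt q * π := by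
    have hprod := mul_le_mul_of_nonneg_left hconst hsq.le
    have hAq : Real.sqrt q * (Real.log q / 2) = A / 2 := by rw [hA]; ring
    linarith [hmain, hT, hprod, hAq]
  have hfin : (2 * (Real.sqrt q * ∑ m ∈ range n, 1 / ((m + 1 : ℕ) : ℝ)) +
      2 * (1 / ((n : ℝ) + 1 / 2) * ∑ r ∈ Ico 1 q, 1 / Real.sin (π * r / q))) / π ≤
      A / π + 2 * Real.sqrt q * Real.log (Real.log q) / π + 2 * Real.sqrt q := by
    rw [div_le_iff₀ hπ]
    have : (A / π + 2 * Real.sqrt q * Real.log (Real.log q) / π + 2 * Real.sqrt q) * π =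
        A + 2 * Real.sqrt q * Real.log (Real.log q) + 2 * Real.sqrt q * π := by
      field_simp
    rw [this]; exact key
  have hcast : ((⌊2 * Real.sqrt q * Real.log q⌋₊ + 1 : ℕ) : ℝ) = (n : ℝ) := by rw [hn]
  rw [hcast, hA]
  rw [hA] at hfin
  linarith

/-- **The parity-free block bound**: for `χ` primitive mod `q ≥ 3`, an integer `u` and `1 ≤ L ≤ q`,
`|Σ_{0<k<L} χ(u + k)| ≤ √q log q/π + 2√q log log q/π + 2√q + 1`. [cite: Pomerance2011, §1 (2)] -/
theorem norm_sum_char_block_le' {χ : DirichletCharacter ℂ q} (hχ : χ.IsPrimitive) (hq : 3 ≤ q)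
    (u : ℤ) {L : ℕ} (hL1 : 1 ≤ L) (hLq : L ≤ q) :
    ‖∑ k ∈ Ico 1 L, χ (((u + k : ℤ)) : ZMod q)‖ ≤
      Real.sqrt q * Real.log q / π + 2 * Real.sqrt q * Real.log (Real.log q) / π +
        2 * Real.sqrt q + 1 :=
  (norm_sum_char_block_le_raw' hχ (by omega) u hL1 hLq _).trans (block_bound_numerics' hq)

/-- There is no primitive character modulo `2`. [folklore] -/
private theorem not_isPrimitive_two (χ : DirichletCharacter ℂ 2) : ¬χ.IsPrimitive := by
  intro hχ
  have h1 : χ = 1 := MulChar.ext fun u => by rw [Subsingleton.elim u 1]; simp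
  exact ne_one_of_isPrimitive hχ le_rfl h1

/-- **Pólya–Vinogradov for all primitive characters with Landau's constant `1/π`, integer intervals**:
for `χ` primitive mod `q ≥ 2`, every integer `a` and every `N`,
`|Σ_{a ≤ j < a+N} χ(j)| ≤ √q log q/π + 2√q log log q/π + 2√q + 1`.
[cite: Pomerance2011, §1 (2)] -/
theorem polyaVinogradov_one_div_pi_int (hq : 2 ≤ q) {χ : DirichletCharacter ℂ q}
    (hχ : χ.IsPrimitive) (a : ℤ) (N : ℕ) :
    ‖∑ j ∈ Ico a (a + N), χ ((j : ZMod q))‖ ≤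
      Real.sqrt q * Real.log q / π + 2 * Real.sqrt q * Real.log (Real.log q) / π +
        2 * Real.sqrt q + 1 := by
  rcases Nat.lt_or_ge q 3 with h2 | h3
  · exfalso
    have : q = 2 := by omega
    subst this
    exact not_isPrimitive_two χ hχ
  have hq0 : 0 < q := by omega
  set t : ℕ := N / q with ht
  set r : ℕ := N % q with hr
  have hrq : r < q := Nat.mod_lt N hq0
  have hN : (N : ℤ) = ((q * t : ℕ) : ℤ) + (r : ℤ) := by
    rw [ht, hr]; exact_mod_cast (Nat.div_add_mod N q).symm
  have hsplit : Ico a (a + N) = Ico a (a + (q * t : ℕ)) ∪ Ico (a + (q * t : ℕ)) (a + (q * t : ℕ) + r) := by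
    rw [Finset.Ico_union_Ico_eq_Ico (le_add_of_nonneg_right (by positivity))
      (le_add_of_nonneg_right (by positivity)), hN, add_assoc]
  rw [hsplit, Finset.sum_union (Finset.Ico_disjoint_Ico_consecutive _ _ _),
    sum_char_Ico_period_mul_eq_zero (ne_one_of_isPrimitive hχ hq), zero_add, sum_Ico_int_eq_sum_range]
  set b : ℤ := a + (q * t : ℕ) with hb
  have hblock : ∑ k ∈ range r, χ (((b + k : ℤ)) : ZMod q) =
      ∑ k ∈ Ico 1 (r + 1), χ ((((b - 1) + k : ℤ)) : ZMod q) := by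
    rw [Finset.sum_Ico_eq_sum_range, Nat.add_sub_cancel]
    refine Finset.sum_congr rfl fun k _ => ?_
    congr 1; push_cast; ring
  rw [hblock]
  exact norm_sum_char_block_le' hχ h3 (b - 1) (by omega) (by omega)

end Sawtooth

open Sawtooth in
/-- **The Pólya–Vinogradov inequality for all primitive characters with Landau's constant `1/π`**
(Landau 1918, [Pomerance2011] §1 (2): leading term `(1/π) q^{1/2} log q`; half the tree's
`polyaVinogradov_two_div_pi`): for `χ` primitive mod `q ≥ 2` and every interval `(A, A + N]`,
`|Σ_{A<n≤A+N} χ(n)| ≤ √q log q/π + 2√q log log q/π + 2√q + 1`. [cite: Pomerance2011, §1 (2)] -/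
theorem polyaVinogradov_one_div_pi {q : ℕ} [NeZero q] (hq : 2 ≤ q) {χ : DirichletCharacter ℂ q}
    (hχ : χ.IsPrimitive) (A N : ℕ) :
    ‖∑ n ∈ Ioc A (A + N), χ n‖ ≤
      Real.sqrt q * Real.log q / π + 2 * Real.sqrt q * Real.log (Real.log q) / π +
        2 * Real.sqrt q + 1 := by
  have h := sum_Ioc_nat_eq_sum_Ico_int (fun j : ℤ => χ ((j : ZMod q))) A N
  simp only [Int.cast_natCast] at h
  rw [h]
  exact polyaVinogradov_one_div_pi_int hq hχ _ _

open Sawtooth in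
/-- The same for closed intervals `[M, N] ⊆ ℕ`. [cite: Pomerance2011, §1 (2)] -/
theorem polyaVinogradov_one_div_pi_Icc {q : ℕ} [NeZero q] (hq : 2 ≤ q)
    {χ : DirichletCharacter ℂ q} (hχ : χ.IsPrimitive) (M N : ℕ) :
    ‖∑ n ∈ Icc M N, χ n‖ ≤
      Real.sqrt q * Real.log q / π + 2 * Real.sqrt q * Real.log (Real.log q) / π +
        2 * Real.sqrt q + 1 := by
  have h := sum_Icc_nat_eq_sum_Ico_int (fun j : ℤ => χ ((j : ZMod q))) M N
  simp only [Int.cast_natCast] at h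
  rw [h]
  exact polyaVinogradov_one_div_pi_int hq hχ _ _


/-! ### Even characters: the Landau–Bateman–Pomerance constant `2/π²`

For even `χ` the sines of the main term do not cancel and the mean value `2/π` of `|sin|` enters
([Pomerance2011] §2 Lemma 3, from the Fourier series `|sin θ| = 2/π − (4/π)Σ_{m≥1} cos(2mθ)/(4m²−1)`,
Pólya–Szegő VI.34 — in the tree as `Literature.Analysis.Fourier.hasSum_abs_sin_nat`): with the cosine-sum
bound `C_n ≥ −(π+1)` of this file, `Σ_{j≤n} |sin(jx)|/j ≤ (2/π)(H_n + π + 1)` at the points `x = 2πw/q`,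
whence the block bound with main term `(4/π)√q (H_n + π + 1)/π` and the leading constant `2/π²`. -/

namespace Sawtooth

variable {q : ℕ} [NeZero q]

/-- **Even primitive characters against sines** ([Pomerance2011] §2 (8), (10) even case, shifted by
`w`): for `χ` primitive and even mod `q` and integers `u, w, m`,
`Σ_{k<q} χ(u + k) sin(2π m (u + k − w)/q) = −τ(χ) χ⁻¹(m) sin(2π m w/q)`. [cite: Pomerance2011, §2 (7)–(10)] -/
theorem sum_char_shift_mul_sin_even {χ : DirichletCharacter ℂ q} (hχ : χ.IsPrimitive) (heven : χ.Even)
    (u w m : ℤ) :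
    ∑ k ∈ range q, χ (((u + k : ℤ)) : ZMod q) *
        ((Real.sin (2 * π * ((m : ℝ) * ((u + k - w : ℤ) : ℝ) / q)) : ℝ) : ℂ) =
      -(gaussSum χ ZMod.stdAddChar * χ⁻¹ (m : ZMod q)) *
        ((Real.sin (2 * π * ((m : ℝ) * (w : ℝ) / q)) : ℝ) : ℂ) := by
  have hτ := sum_char_shift_mul_e hχ u m
  have hτ' := sum_char_shift_mul_e hχ u (-m)
  have heven' : χ (-1) = 1 := heven
  have hneg : χ⁻¹ ((-m : ℤ) : ZMod q) = χ⁻¹ (m : ZMod q) := by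
    rw [Int.cast_neg, neg_eq_neg_one_mul, map_mul, inv_apply_neg_one, heven', one_mul]
  rw [hneg] at hτ'
  have hterm : ∀ k : ℕ, χ (((u + k : ℤ)) : ZMod q) *
      ((Real.sin (2 * π * ((m : ℝ) * ((u + k - w : ℤ) : ℝ) / q)) : ℝ) : ℂ) =
      χ (((u + k : ℤ)) : ZMod q) * e (((-m : ℤ) : ℝ) * ((u + k : ℤ) : ℝ) / q) *
          (e ((m : ℝ) * (w : ℝ) / q) * Complex.I / 2) -
        χ (((u + k : ℤ)) : ZMod q) * e ((m : ℝ) * ((u + k : ℤ) : ℝ) / q) *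
          (e (-((m : ℝ) * (w : ℝ) / q)) * Complex.I / 2) := by
    intro k
    rw [ofReal_sin_two_pi_mul]
    have e1 : e (-((m : ℝ) * ((u + k - w : ℤ) : ℝ) / q)) =
        e (((-m : ℤ) : ℝ) * ((u + k : ℤ) : ℝ) / q) * e ((m : ℝ) * (w : ℝ) / q) := by
      rw [← e_add]; congr 1; push_cast; ring
    have e2 : e ((m : ℝ) * ((u + k - w : ℤ) : ℝ) / q) =
        e ((m : ℝ) * ((u + k : ℤ) : ℝ) / q) * e (-((m : ℝ) * (w : ℝ) / q)) := by
      rw [← e_add]; congr 1; push_cast; ring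
    rw [e1, e2]; ring
  rw [Finset.sum_congr rfl fun k _ => hterm k, Finset.sum_sub_distrib, ← Finset.sum_mul,
    ← Finset.sum_mul, hτ, hτ', ofReal_sin_two_pi_mul]
  ring

/-- **The character sum against the sawtooth partial sum, even case**: for `χ` primitive and even,
`Σ_{k<q} χ(u + k) P_n(2π(u + k − w)/q) = −τ(χ) Σ_{m=1}^{n} (χ⁻¹(m)/m) sin(2π m w/q)`.
[cite: Pomerance2011, §3 (display for `A_n`)] -/
theorem sum_char_shift_mul_sinSum_even {χ : DirichletCharacter ℂ q} (hχ : χ.IsPrimitive)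
    (heven : χ.Even) (n : ℕ) (u w : ℤ) :
    ∑ k ∈ range q, χ (((u + k : ℤ)) : ZMod q) *
        ((sinSum n (2 * π * ((u + k - w : ℤ) : ℝ) / q) : ℝ) : ℂ) =
      -gaussSum χ ZMod.stdAddChar *
        ∑ m ∈ range n, χ⁻¹ ((m + 1 : ℕ) : ZMod q) / ((m + 1 : ℕ) : ℂ) *
          ((Real.sin ((m + 1 : ℕ) * (2 * π * w / q)) : ℝ) : ℂ) := by
  have hexp : ∀ k : ℕ, ((sinSum n (2 * π * ((u + k - w : ℤ) : ℝ) / q) : ℝ) : ℂ) =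
      ∑ m ∈ range n, ((Real.sin (2 * π * ((((m + 1 : ℕ) : ℤ) : ℝ) * ((u + k - w : ℤ) : ℝ) / q))
        : ℝ) : ℂ) / ((m + 1 : ℕ) : ℂ) := by
    intro k
    unfold sinSum
    rw [Complex.ofReal_sum]
    refine Finset.sum_congr rfl fun m _ => ?_
    have : ((m + 1 : ℕ) : ℝ) * (2 * π * ((u + k - w : ℤ) : ℝ) / q) =
        2 * π * ((((m + 1 : ℕ) : ℤ) : ℝ) * ((u + k - w : ℤ) : ℝ) / q) := by push_cast; ring
    rw [this, Complex.ofReal_div, Complex.ofReal_natCast]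
  simp_rw [hexp, Finset.mul_sum]
  rw [Finset.sum_comm]
  refine Finset.sum_congr rfl fun m _ => ?_
  have h := sum_char_shift_mul_sin_even hχ heven u w ((m + 1 : ℕ) : ℤ)
  have : ∑ k ∈ range q, χ (((u + k : ℤ)) : ZMod q) *
      (((Real.sin (2 * π * ((((m + 1 : ℕ) : ℤ) : ℝ) * ((u + k - w : ℤ) : ℝ) / q)) : ℝ) : ℂ) /
        ((m + 1 : ℕ) : ℂ)) =
      (∑ k ∈ range q, χ (((u + k : ℤ)) : ZMod q) *
        ((Real.sin (2 * π * ((((m + 1 : ℕ) : ℤ) : ℝ) * ((u + k - w : ℤ) : ℝ) / q)) : ℝ) : ℂ)) /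
        ((m + 1 : ℕ) : ℂ) := by
    rw [Finset.sum_div]
    exact Finset.sum_congr rfl fun k _ => by ring
  rw [this, h]
  simp only [Int.cast_natCast]
  have hc : Real.sin (2 * π * (((m + 1 : ℕ) : ℝ) * (w : ℝ) / q)) =
      Real.sin ((m + 1 : ℕ) * (2 * π * w / q)) := by
    congr 1; ring
  rw [hc]
  ring

/-- **Mean value of `|sin|` along an arithmetic progression** (from the Fourier series of `|sin|`,
[Pomerance2011] §2 Lemma 3 has `S_n(x) < (2/π)(log n + γ + log 2 + 3/n)` for all real `x`; here with
`C_n ≥ −(π+1)` at the lattice points): for every integer `w`,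
`Σ_{j=1}^{n} |sin(j · 2πw/q)|/j ≤ (2/π)(H_n + π + 1)`. [cite: Pomerance2011, §2 Lemma 3] -/
theorem sum_abs_sin_div_le (n : ℕ) (w : ℤ) :
    ∑ m ∈ range n, |Real.sin ((m + 1 : ℕ) * (2 * π * w / q))| / ((m + 1 : ℕ) : ℝ) ≤
      2 / π * (∑ m ∈ range n, 1 / ((m + 1 : ℕ) : ℝ) + (π + 1)) := by
  set x : ℝ := 2 * π * w / q with hx
  -- the Fourier series of `|sin|` at the points `j x`, divided by `j`, summed over `j ≤ n`
  have hj : ∀ j ∈ range n, HasSum (fun m : ℕ =>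
      4 / (π * (4 * ((m : ℝ) + 1) ^ 2 - 1)) * Real.cos (2 * ((m : ℝ) + 1) * ((j + 1 : ℕ) * x)) /
        ((j + 1 : ℕ) : ℝ)) ((2 / π - |Real.sin ((j + 1 : ℕ) * x)|) / ((j + 1 : ℕ) : ℝ)) :=
    fun j _ => (Literature.Analysis.Fourier.hasSum_abs_sin_nat ((j + 1 : ℕ) * x)).div_const _
  have hsum := hasSum_sum hj
  -- the coefficients sum to `2/π` (the series at `θ = 0`)
  have h0 := Literature.Analysis.Fourier.hasSum_abs_sin_nat 0
  simp only [mul_zero, Real.cos_zero, mul_one, Real.sin_zero, abs_zero, sub_zero] at h0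
  have hlow := h0.mul_left (-(π + 1))
  -- termwise comparison: `d_m C_n(2(m+1)x) ≥ −(π+1) d_m`
  have hle : ∀ m : ℕ, -(π + 1) * (4 / (π * (4 * ((m : ℝ) + 1) ^ 2 - 1))) ≤
      ∑ j ∈ range n, 4 / (π * (4 * ((m : ℝ) + 1) ^ 2 - 1)) *
        Real.cos (2 * ((m : ℝ) + 1) * ((j + 1 : ℕ) * x)) / ((j + 1 : ℕ) : ℝ) := by
    intro m
    have hd : 0 < 4 / (π * (4 * ((m : ℝ) + 1) ^ 2 - 1)) := by
      have : (0 : ℝ) < 4 * ((m : ℝ) + 1) ^ 2 - 1 := by nlinarith [Nat.cast_nonneg (α := ℝ) m]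
      positivity
    have hC := neg_pi_add_one_le_cosSum (q := q) n (2 * ((m : ℤ) + 1) * w)
    have hCe : cosSum n (2 * π * ((2 * ((m : ℤ) + 1) * w : ℤ) : ℝ) / q) =
        ∑ j ∈ range n, Real.cos (2 * ((m : ℝ) + 1) * ((j + 1 : ℕ) * x)) / ((j + 1 : ℕ) : ℝ) := by
      unfold cosSum
      refine Finset.sum_congr rfl fun j _ => ?_
      congr 2; rw [hx]; push_cast; ring
    rw [hCe] at hC
    have : ∑ j ∈ range n, 4 / (π * (4 * ((m : ℝ) + 1) ^ 2 - 1)) *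
        Real.cos (2 * ((m : ℝ) + 1) * ((j + 1 : ℕ) * x)) / ((j + 1 : ℕ) : ℝ) =
        4 / (π * (4 * ((m : ℝ) + 1) ^ 2 - 1)) *
          ∑ j ∈ range n, Real.cos (2 * ((m : ℝ) + 1) * ((j + 1 : ℕ) * x)) / ((j + 1 : ℕ) : ℝ) := by
      rw [Finset.mul_sum]
      exact Finset.sum_congr rfl fun j _ => by ring
    rw [this]
    nlinarith
  have hcmp := hasSum_le hle hlow hsum
  -- unpack
  have hsplit : ∑ j ∈ range n, (2 / π - |Real.sin ((j + 1 : ℕ) * x)|) / ((j + 1 : ℕ) : ℝ) =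
      2 / π * ∑ j ∈ range n, 1 / ((j + 1 : ℕ) : ℝ) -
        ∑ j ∈ range n, |Real.sin ((j + 1 : ℕ) * x)| / ((j + 1 : ℕ) : ℝ) := by
    rw [Finset.mul_sum, ← Finset.sum_sub_distrib]
    exact Finset.sum_congr rfl fun j _ => by ring
  rw [hsplit] at hcmp
  have h2π : -(π + 1) * (2 / π) = -(2 / π * (π + 1)) := by ring
  rw [h2π] at hcmp
  linarith

/-- **The main term over one period, even case**: for `χ` primitive and even mod `q` and integers
`u, w₁, w₂`, `|Σ_{k<q} χ(u+k) (P_n(2π(u+k−w₁)/q) − P_n(2π(u+k−w₂)/q))| ≤ (4/π) √q (H_n + π + 1)`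
([Pomerance2011] §3: `|A_n| ≤ (√q/π) S_n(β)`, Lemma 3). [cite: Pomerance2011, §3 (estimate of `A_n`)] -/
theorem norm_sum_char_mul_sinSum_sub_le_even {χ : DirichletCharacter ℂ q} (hχ : χ.IsPrimitive)
    (heven : χ.Even) (n : ℕ) (u w₁ w₂ : ℤ) :
    ‖∑ k ∈ range q, χ (((u + k : ℤ)) : ZMod q) *
        ((sinSum n (2 * π * ((u + k - w₁ : ℤ) : ℝ) / q) -
          sinSum n (2 * π * ((u + k - w₂ : ℤ) : ℝ) / q) : ℝ) : ℂ)‖ ≤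
      Real.sqrt q * (4 / π * (∑ m ∈ range n, 1 / ((m + 1 : ℕ) : ℝ) + (π + 1))) := by
  have h1 := sum_char_shift_mul_sinSum_even hχ heven n u w₁
  have h2 := sum_char_shift_mul_sinSum_even hχ heven n u w₂
  have hsplit : ∑ k ∈ range q, χ (((u + k : ℤ)) : ZMod q) *
        ((sinSum n (2 * π * ((u + k - w₁ : ℤ) : ℝ) / q) -
          sinSum n (2 * π * ((u + k - w₂ : ℤ) : ℝ) / q) : ℝ) : ℂ) =
      ∑ k ∈ range q, χ (((u + k : ℤ)) : ZMod q) *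
          ((sinSum n (2 * π * ((u + k - w₁ : ℤ) : ℝ) / q) : ℝ) : ℂ) -
        ∑ k ∈ range q, χ (((u + k : ℤ)) : ZMod q) *
          ((sinSum n (2 * π * ((u + k - w₂ : ℤ) : ℝ) / q) : ℝ) : ℂ) := by
    rw [← Finset.sum_sub_distrib]
    refine Finset.sum_congr rfl fun k _ => ?_
    rw [Complex.ofReal_sub, mul_sub]
  rw [hsplit, h1, h2, ← mul_sub, ← Finset.sum_sub_distrib, norm_mul, norm_neg,
    norm_gaussSum_eq_sqrt hχ]
  refine mul_le_mul_of_nonneg_left ?_ (Real.sqrt_nonneg _)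
  refine (norm_sum_le _ _).trans ?_
  have hS1 := sum_abs_sin_div_le (q := q) n w₁
  have hS2 := sum_abs_sin_div_le (q := q) n w₂
  calc ∑ m ∈ range n, ‖χ⁻¹ ((m + 1 : ℕ) : ZMod q) / ((m + 1 : ℕ) : ℂ) *
          ((Real.sin ((m + 1 : ℕ) * (2 * π * w₁ / q)) : ℝ) : ℂ) -
        χ⁻¹ ((m + 1 : ℕ) : ZMod q) / ((m + 1 : ℕ) : ℂ) *
          ((Real.sin ((m + 1 : ℕ) * (2 * π * w₂ / q)) : ℝ) : ℂ)‖
      ≤ ∑ m ∈ range n, (|Real.sin ((m + 1 : ℕ) * (2 * π * w₁ / q))| / ((m + 1 : ℕ) : ℝ) +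
          |Real.sin ((m + 1 : ℕ) * (2 * π * w₂ / q))| / ((m + 1 : ℕ) : ℝ)) := by
        refine Finset.sum_le_sum fun m _ => ?_
        rw [← mul_sub, ← Complex.ofReal_sub, norm_mul, norm_div, Complex.norm_real,
          Complex.norm_natCast, Real.norm_eq_abs, ← add_div, div_mul_eq_mul_div]
        have hm : (0 : ℝ) < ((m + 1 : ℕ) : ℝ) := by positivity
        rw [div_le_div_iff_of_pos_right hm]
        calc ‖χ⁻¹ ((m + 1 : ℕ) : ZMod q)‖ *
              |Real.sin ((m + 1 : ℕ) * (2 * π * w₁ / q)) - Real.sin ((m + 1 : ℕ) * (2 * π * w₂ / q))|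
            ≤ 1 * |Real.sin ((m + 1 : ℕ) * (2 * π * w₁ / q)) -
                Real.sin ((m + 1 : ℕ) * (2 * π * w₂ / q))| :=
              mul_le_mul_of_nonneg_right (χ⁻¹.norm_le_one _) (abs_nonneg _)
          _ ≤ _ := by rw [one_mul]; exact abs_sub _ _
    _ = ∑ m ∈ range n, |Real.sin ((m + 1 : ℕ) * (2 * π * w₁ / q))| / ((m + 1 : ℕ) : ℝ) +
          ∑ m ∈ range n, |Real.sin ((m + 1 : ℕ) * (2 * π * w₂ / q))| / ((m + 1 : ℕ) : ℝ) :=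
        Finset.sum_add_distrib
    _ ≤ _ := by
        have h4 : 4 / π * (∑ m ∈ range n, 1 / ((m + 1 : ℕ) : ℝ) + (π + 1)) =
            2 * (2 / π * (∑ m ∈ range n, 1 / ((m + 1 : ℕ) : ℝ) + (π + 1))) := by ring
        rw [h4]; linarith

/-- **One block, even case, truncation `n` free**: for `χ` primitive and even mod `q ≥ 2`, an integer
`u` and `1 ≤ L ≤ q`, `|Σ_{0<k<L} χ(u+k)| ≤ 1 + ((4/π)√q (H_n + π + 1) + (2/(n+½)) Σ_{0<r<q} csc(πr/q))/π`.
[cite: Pomerance2011, §3 (bound for `Σ_{a≤N} χ(a)`), §2 Lemma 4] -/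
theorem norm_sum_char_block_le_raw_even {χ : DirichletCharacter ℂ q} (hχ : χ.IsPrimitive)
    (heven : χ.Even) (hq : 2 ≤ q) (u : ℤ) {L : ℕ} (hL1 : 1 ≤ L) (hLq : L ≤ q) (n : ℕ) :
    ‖∑ k ∈ Ico 1 L, χ (((u + k : ℤ)) : ZMod q)‖ ≤
      1 + (Real.sqrt q * (4 / π * (∑ m ∈ range n, 1 / ((m + 1 : ℕ) : ℝ) + (π + 1))) +
        2 * (1 / (n + 1 / 2) * ∑ r ∈ Ico 1 q, 1 / Real.sin (π * r / q))) / π := by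
  have hπ := Real.pi_pos
  set g : ℤ → ℂ := fun z => χ ((z : ZMod q)) with hg
  have hper : L = q → g (u + q) = g u := by
    intro _; simp only [hg]; push_cast; rw [ZMod.natCast_self, add_zero]
  have hid := sum_mul_sawZ_sub_sawZ g u hL1 hLq hper
  have hzero : ∑ k ∈ range q, g (u + k) = 0 := sum_char_shift_eq_zero (ne_one_of_isPrimitive hχ hq) u
  rw [hzero, mul_zero, sub_zero] at hid
  have hdec : ∀ k : ℕ, ((sawZ q k - sawZ q ((k : ℤ) - L) : ℝ) : ℂ) =
      ((sinSum n (2 * π * ((u + k - u : ℤ) : ℝ) / q) -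
          sinSum n (2 * π * ((u + k - (u + L) : ℤ) : ℝ) / q) : ℝ) : ℂ)
      + ((sawZ q ((u + k : ℤ) - u) - sinSum n (2 * π * (((u + k : ℤ) - u : ℤ) : ℝ) / q) : ℝ) : ℂ)
      - ((sawZ q ((u + k : ℤ) - (u + L)) -
          sinSum n (2 * π * (((u + k : ℤ) - (u + L) : ℤ) : ℝ) / q) : ℝ) : ℂ) := by
    intro k
    have e1 : sawZ q k = sawZ q ((u + k : ℤ) - u) := by congr 1; ring
    have e2 : sawZ q ((k : ℤ) - L) = sawZ q ((u + k : ℤ) - (u + L)) := by congr 1; ring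
    rw [e1, e2]; push_cast; ring
  have hsum : ∑ k ∈ range q, g (u + k) * ((sawZ q k - sawZ q ((k : ℤ) - L) : ℝ) : ℂ) =
      ∑ k ∈ range q, χ (((u + k : ℤ)) : ZMod q) *
          ((sinSum n (2 * π * ((u + k - u : ℤ) : ℝ) / q) -
            sinSum n (2 * π * ((u + k - (u + L) : ℤ) : ℝ) / q) : ℝ) : ℂ)
        + ∑ k ∈ range q, χ (((u + k : ℤ)) : ZMod q) *
          ((sawZ q ((u + k : ℤ) - u) - sinSum n (2 * π * (((u + k : ℤ) - u : ℤ) : ℝ) / q) : ℝ) : ℂ)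
        - ∑ k ∈ range q, χ (((u + k : ℤ)) : ZMod q) *
          ((sawZ q ((u + k : ℤ) - (u + L)) -
            sinSum n (2 * π * (((u + k : ℤ) - (u + L) : ℤ) : ℝ) / q) : ℝ) : ℂ) := by
    rw [← Finset.sum_add_distrib, ← Finset.sum_sub_distrib]
    refine Finset.sum_congr rfl fun k _ => ?_
    rw [hdec k]; simp only [hg]; ring
  have hM := norm_sum_char_mul_sinSum_sub_le_even hχ heven n u u (u + L)
  have hT1 := norm_sum_char_mul_tail_le n χ u u
  have hT2 := norm_sum_char_mul_tail_le n χ u (u + L)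
  have hS' : ‖g u / 2 + ∑ k ∈ Ico 1 L, g (u + k) + g (u + L) / 2‖ ≤
      (Real.sqrt q * (4 / π * (∑ m ∈ range n, 1 / ((m + 1 : ℕ) : ℝ) + (π + 1))) +
        2 * (1 / (n + 1 / 2) * ∑ r ∈ Ico 1 q, 1 / Real.sin (π * r / q))) / π := by
    rw [le_div_iff₀ hπ]
    have hnorm : ‖g u / 2 + ∑ k ∈ Ico 1 L, g (u + k) + g (u + L) / 2‖ * π =
        ‖(π : ℂ) * (g u / 2 + ∑ k ∈ Ico 1 L, g (u + k) + g (u + L) / 2)‖ := by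
      rw [norm_mul, Complex.norm_real, Real.norm_eq_abs, abs_of_pos hπ, mul_comm]
    rw [hnorm, ← hid, hsum]
    refine (norm_sub_le _ _).trans ?_
    refine (add_le_add (norm_add_le _ _) le_rfl).trans ?_
    linarith
  have hends : ∑ k ∈ Ico 1 L, χ (((u + k : ℤ)) : ZMod q) =
      (g u / 2 + ∑ k ∈ Ico 1 L, g (u + k) + g (u + L) / 2) - g u / 2 - g (u + L) / 2 := by
    simp only [hg]; ring
  rw [hends]
  have h1 : ‖g u / 2‖ ≤ 1 / 2 := by
    simp only [hg]; rw [norm_div, Complex.norm_two]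
    linarith [χ.norm_le_one ((u : ℤ) : ZMod q)]
  have h2 : ‖g (u + L) / 2‖ ≤ 1 / 2 := by
    simp only [hg]; rw [norm_div, Complex.norm_two]
    linarith [χ.norm_le_one ((u + L : ℤ) : ZMod q)]
  calc ‖(g u / 2 + ∑ k ∈ Ico 1 L, g (u + k) + g (u + L) / 2) - g u / 2 - g (u + L) / 2‖
      ≤ ‖(g u / 2 + ∑ k ∈ Ico 1 L, g (u + k) + g (u + L) / 2) - g u / 2‖ + ‖g (u + L) / 2‖ :=
        norm_sub_le _ _
    _ ≤ ‖g u / 2 + ∑ k ∈ Ico 1 L, g (u + k) + g (u + L) / 2‖ + ‖g u / 2‖ + ‖g (u + L) / 2‖ :=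
        add_le_add (norm_sub_le _ _) le_rfl
    _ ≤ _ := by linarith

omit [NeZero q] in
set_option maxHeartbeats 400000 in
/-- Numerics for the even block bound with `n = ⌊2√q log q⌋ + 1` (`q ≥ 3`):
`4(2 + log 3)/π + 4 + 2/π + 2/5 ≤ 3π` (`log 3 ≤ log 2 + ½`). [folklore] -/
private theorem block_bound_numerics_even (hq : 3 ≤ q) :
    1 + (Real.sqrt q * (4 / π * (∑ m ∈ range (⌊2 * Real.sqrt q * Real.log q⌋₊ + 1),
        1 / ((m + 1 : ℕ) : ℝ) + (π + 1))) +
      2 * (1 / ((⌊2 * Real.sqrt q * Real.log q⌋₊ + 1 : ℕ) + 1 / 2) *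
        ∑ r ∈ Ico 1 q, 1 / Real.sin (π * r / q))) / π ≤
      2 / π ^ 2 * Real.sqrt q * Real.log q + 4 / π ^ 2 * Real.sqrt q * Real.log (Real.log q) +
        3 * Real.sqrt q + 1 := by
  have hπ := Real.pi_pos
  have hπ3 := Real.pi_gt_d2
  have hqR : (3 : ℝ) ≤ q := by exact_mod_cast hq
  have hq0 : (0 : ℝ) < q := by linarith
  have hsq : 0 < Real.sqrt q := Real.sqrt_pos.mpr hq0
  have hsq1 : 1 ≤ Real.sqrt q := by
    rw [show (1 : ℝ) = Real.sqrt 1 from Real.sqrt_one.symm]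
    exact Real.sqrt_le_sqrt (by linarith)
  have hlog1 : 1 ≤ Real.log q := by
    rw [Real.le_log_iff_exp_le hq0]
    have := Real.exp_one_lt_d9
    linarith
  have hlog0 : 0 < Real.log q := by linarith
  set A : ℝ := Real.sqrt q * Real.log q with hA
  have hA1 : 1 ≤ A := by rw [hA]; nlinarith
  have hA0 : 0 < A := by linarith
  set n : ℕ := ⌊2 * Real.sqrt q * Real.log q⌋₊ + 1 with hn
  have hn2A : 2 * A < n := by
    rw [hn, hA]; push_cast
    have := Nat.lt_floor_add_one (2 * Real.sqrt q * Real.log q)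
    linarith
  have hnle : (n : ℝ) ≤ 3 * A := by
    rw [hn, hA]; push_cast
    have := Nat.floor_le (by positivity : (0 : ℝ) ≤ 2 * Real.sqrt q * Real.log q)
    nlinarith
  have hn0 : (0 : ℝ) < n := by linarith
  have hH : ∑ m ∈ range n, 1 / ((m + 1 : ℕ) : ℝ) ≤ 1 + Real.log n := by
    have h := harmonic_le_one_add_log n
    have : ((harmonic n : ℚ) : ℝ) = ∑ m ∈ range n, 1 / ((m + 1 : ℕ) : ℝ) := by
      simp [harmonic, one_div]
    rw [← this]; exact h
  have hlogn : Real.log n ≤ Real.log 3 + Real.log q / 2 + Real.log (Real.log q) := by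
    calc Real.log n ≤ Real.log (3 * A) := Real.log_le_log hn0 hnle
      _ = Real.log 3 + Real.log (Real.sqrt q) + Real.log (Real.log q) := by
          rw [hA, Real.log_mul (by norm_num) (by positivity), Real.log_mul hsq.ne' hlog0.ne']
          ring
      _ = _ := by rw [Real.log_sqrt hq0.le]
  have hlog3 : Real.log 3 ≤ 1.1932 := by
    have h32 : Real.log 3 = Real.log 2 + Real.log (3 / 2) := by
      rw [← Real.log_mul (by norm_num) (by norm_num)]; norm_num
    have h15 : Real.log (3 / 2) ≤ 3 / 2 - 1 := Real.log_le_sub_one_of_pos (by norm_num)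
    have := Real.log_two_lt_d9
    linarith
  have hlog3' : 0 ≤ Real.log 3 := Real.log_nonneg (by norm_num)
  have hcsc : ∑ r ∈ Ico 1 q, 1 / Real.sin (π * r / q) ≤ 2 / π * q * Real.log q + 2 / 5 * q :=
    Literature.Analysis.Quadrature.sum_inv_sin_le (by omega)
  have hT : 1 / ((n : ℝ) + 1 / 2) * ∑ r ∈ Ico 1 q, 1 / Real.sin (π * r / q) ≤
      Real.sqrt q * π⁻¹ + Real.sqrt q / 5 := by
    have hinv : 1 / ((n : ℝ) + 1 / 2) ≤ 1 / (2 * A) :=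
      one_div_le_one_div_of_le (by positivity) (by linarith)
    calc 1 / ((n : ℝ) + 1 / 2) * ∑ r ∈ Ico 1 q, 1 / Real.sin (π * r / q)
        ≤ 1 / (2 * A) * (2 / π * q * Real.log q + 2 / 5 * q) :=
          mul_le_mul hinv hcsc (by
            refine Finset.sum_nonneg fun r hr => ?_
            rw [Finset.mem_Ico] at hr
            have hr0 : (0 : ℝ) < r := by exact_mod_cast hr.1
            have hrq : (r : ℝ) < q := by exact_mod_cast hr.2
            have : 0 < Real.sin (π * r / q) := by
              refine Real.sin_pos_of_pos_of_lt_pi (by positivity) ?_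
              rw [div_lt_iff₀ hq0]; nlinarith
            positivity) (by positivity)
      _ = Real.sqrt q / π + Real.sqrt q / (5 * Real.log q) := by
          rw [hA]
          have hsq2 : Real.sqrt q * Real.sqrt q = q := Real.mul_self_sqrt hq0.le
          field_simp
          nlinarith [hsq2]
      _ ≤ Real.sqrt q * π⁻¹ + Real.sqrt q / 5 := by
          rw [← div_eq_mul_inv]
          have : Real.sqrt q / (5 * Real.log q) ≤ Real.sqrt q / 5 :=
            div_le_div_of_nonneg_left hsq.le (by norm_num) (by nlinarith)
          linarith
  -- the constant: `4π⁻¹(2 + log 3) + 4 + 2π⁻¹ + 2/5 ≤ 3π`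
  have h2π : π⁻¹ ≤ (3.14 : ℝ)⁻¹ := inv_anti₀ (by norm_num) hπ3.le
  have h314 : (3.14 : ℝ)⁻¹ ≤ 0.3185 := by norm_num
  have hπi0 : 0 ≤ π⁻¹ := inv_nonneg.mpr hπ.le
  have hpl : π⁻¹ * Real.log 3 ≤ 0.3185 * 1.1932 :=
    mul_le_mul (h2π.trans h314) hlog3 hlog3' (by norm_num)
  have hconst : 4 * π⁻¹ * (2 + Real.log 3) + 4 + 2 * π⁻¹ + 2 / 5 ≤ 3 * π := by nlinarith
  -- assemble
  have h4π : (0 : ℝ) ≤ 4 * π⁻¹ := by positivity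
  have hmain : Real.sqrt q * (4 / π * (∑ m ∈ range n, 1 / ((m + 1 : ℕ) : ℝ) + (π + 1))) ≤
      Real.sqrt q * (4 * π⁻¹ * (2 + Real.log 3 + Real.log q / 2 + Real.log (Real.log q) + π)) := by
    rw [div_eq_mul_inv]
    refine mul_le_mul_of_nonneg_left (mul_le_mul_of_nonneg_left (by linarith) h4π) hsq.le
  have hππ : Real.sqrt q * π⁻¹ * π = Real.sqrt q := by field_simp
  have hAq : Real.sqrt q * π⁻¹ * Real.log q = π⁻¹ * A := by rw [hA]; ring
  have hprod := mul_le_mul_of_nonneg_left hconst hsq.le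
  have key : Real.sqrt q * (4 / π * (∑ m ∈ range n, 1 / ((m + 1 : ℕ) : ℝ) + (π + 1))) +
      2 * (1 / ((n : ℝ) + 1 / 2) * ∑ r ∈ Ico 1 q, 1 / Real.sin (π * r / q)) ≤
      2 * π⁻¹ * A + 4 * π⁻¹ * (Real.sqrt q * Real.log (Real.log q)) + 3 * Real.sqrt q * π := by
    linarith [hmain, hT, hprod, hAq, hππ]
  have hfin : (Real.sqrt q * (4 / π * (∑ m ∈ range n, 1 / ((m + 1 : ℕ) : ℝ) + (π + 1))) +
      2 * (1 / ((n : ℝ) + 1 / 2) * ∑ r ∈ Ico 1 q, 1 / Real.sin (π * r / q))) / π ≤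
      2 / π ^ 2 * A + 4 / π ^ 2 * (Real.sqrt q * Real.log (Real.log q)) + 3 * Real.sqrt q := by
    rw [div_le_iff₀ hπ]
    have : (2 / π ^ 2 * A + 4 / π ^ 2 * (Real.sqrt q * Real.log (Real.log q)) + 3 * Real.sqrt q) * π =
        2 * π⁻¹ * A + 4 * π⁻¹ * (Real.sqrt q * Real.log (Real.log q)) + 3 * Real.sqrt q * π := by
      field_simp
    rw [this]; exact key
  have hcast : ((⌊2 * Real.sqrt q * Real.log q⌋₊ + 1 : ℕ) : ℝ) = (n : ℝ) := by rw [hn]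
  rw [hcast]
  rw [hA] at hfin
  linarith

/-- **The even block bound**: for `χ` primitive and even mod `q ≥ 3`, an integer `u` and `1 ≤ L ≤ q`,
`|Σ_{0<k<L} χ(u + k)| ≤ (2/π²)√q log q + (4/π²)√q log log q + 3√q + 1`.
[cite: Pomerance2011, Theorem 1 (even case)] -/
theorem norm_sum_char_block_le_even {χ : DirichletCharacter ℂ q} (hχ : χ.IsPrimitive)
    (heven : χ.Even) (hq : 3 ≤ q) (u : ℤ) {L : ℕ} (hL1 : 1 ≤ L) (hLq : L ≤ q) :
    ‖∑ k ∈ Ico 1 L, χ (((u + k : ℤ)) : ZMod q)‖ ≤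
      2 / π ^ 2 * Real.sqrt q * Real.log q + 4 / π ^ 2 * Real.sqrt q * Real.log (Real.log q) +
        3 * Real.sqrt q + 1 :=
  (norm_sum_char_block_le_raw_even hχ heven (by omega) u hL1 hLq _).trans
    (block_bound_numerics_even hq)

/-- **Pólya–Vinogradov for even primitive characters, integer intervals**: for `χ` primitive mod
`q ≥ 2` with `χ(−1) = 1`, every integer `a` and every `N`,
`|Σ_{a ≤ j < a+N} χ(j)| ≤ (2/π²)√q log q + (4/π²)√q log log q + 3√q + 1`.
[cite: Pomerance2011, Theorem 1 (even case)] -/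
theorem polyaVinogradov_even_int (hq : 2 ≤ q) {χ : DirichletCharacter ℂ q}
    (hχ : χ.IsPrimitive) (heven : χ.Even) (a : ℤ) (N : ℕ) :
    ‖∑ j ∈ Ico a (a + N), χ ((j : ZMod q))‖ ≤
      2 / π ^ 2 * Real.sqrt q * Real.log q + 4 / π ^ 2 * Real.sqrt q * Real.log (Real.log q) +
        3 * Real.sqrt q + 1 := by
  rcases Nat.lt_or_ge q 3 with h2 | h3
  · exfalso
    have : q = 2 := by omega
    subst this
    exact not_isPrimitive_two χ hχ
  have hq0 : 0 < q := by omega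
  set t : ℕ := N / q with ht
  set r : ℕ := N % q with hr
  have hrq : r < q := Nat.mod_lt N hq0
  have hN : (N : ℤ) = ((q * t : ℕ) : ℤ) + (r : ℤ) := by
    rw [ht, hr]; exact_mod_cast (Nat.div_add_mod N q).symm
  have hsplit : Ico a (a + N) = Ico a (a + (q * t : ℕ)) ∪ Ico (a + (q * t : ℕ)) (a + (q * t : ℕ) + r) := by
    rw [Finset.Ico_union_Ico_eq_Ico (le_add_of_nonneg_right (by positivity))
      (le_add_of_nonneg_right (by positivity)), hN, add_assoc]
  rw [hsplit, Finset.sum_union (Finset.Ico_disjoint_Ico_consecutive _ _ _),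
    sum_char_Ico_period_mul_eq_zero (ne_one_of_isPrimitive hχ hq), zero_add, sum_Ico_int_eq_sum_range]
  set b : ℤ := a + (q * t : ℕ) with hb
  have hblock : ∑ k ∈ range r, χ (((b + k : ℤ)) : ZMod q) =
      ∑ k ∈ Ico 1 (r + 1), χ ((((b - 1) + k : ℤ)) : ZMod q) := by
    rw [Finset.sum_Ico_eq_sum_range, Nat.add_sub_cancel]
    refine Finset.sum_congr rfl fun k _ => ?_
    congr 1; push_cast; ring
  rw [hblock]
  exact norm_sum_char_block_le_even hχ heven h3 (b - 1) (by omega) (by omega)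

end Sawtooth

open Sawtooth in
/-- **The Pólya–Vinogradov inequality for even primitive characters with the Bateman–Pomerance constant
`2/π²`** ([Pomerance2011] Theorem 1, even case: `S(χ) ≤ (2/π²)√q log q + (4/π²)√q log log q + (3/2)√q`,
there with the remaining terms absorbed for `q ≥ 21` and a finite check below; here kernel-proved for all
`q ≥ 2` with the explicit secondary term `3√q + 1`): for `χ` primitive mod `q ≥ 2` with `χ(−1) = 1` and
every interval `(A, A + N]`,
`|Σ_{A<n≤A+N} χ(n)| ≤ (2/π²)√q log q + (4/π²)√q log log q + 3√q + 1`.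
[cite: Pomerance2011, Theorem 1 (even case) and §3] -/
theorem polyaVinogradov_even {q : ℕ} [NeZero q] (hq : 2 ≤ q) {χ : DirichletCharacter ℂ q}
    (hχ : χ.IsPrimitive) (heven : χ.Even) (A N : ℕ) :
    ‖∑ n ∈ Ioc A (A + N), χ n‖ ≤
      2 / π ^ 2 * Real.sqrt q * Real.log q + 4 / π ^ 2 * Real.sqrt q * Real.log (Real.log q) +
        3 * Real.sqrt q + 1 := by
  have h := sum_Ioc_nat_eq_sum_Ico_int (fun j : ℤ => χ ((j : ZMod q))) A N
  simp only [Int.cast_natCast] at h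
  rw [h]
  exact polyaVinogradov_even_int hq hχ heven _ _

open Sawtooth in
/-- The same for closed intervals `[M, N] ⊆ ℕ`. [cite: Pomerance2011, Theorem 1 (even case)] -/
theorem polyaVinogradov_even_Icc {q : ℕ} [NeZero q] (hq : 2 ≤ q)
    {χ : DirichletCharacter ℂ q} (hχ : χ.IsPrimitive) (heven : χ.Even) (M N : ℕ) :
    ‖∑ n ∈ Icc M N, χ n‖ ≤
      2 / π ^ 2 * Real.sqrt q * Real.log q + 4 / π ^ 2 * Real.sqrt q * Real.log (Real.log q) +
        3 * Real.sqrt q + 1 := by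
  have h := sum_Icc_nat_eq_sum_Ico_int (fun j : ℤ => χ ((j : ZMod q))) M N
  simp only [Int.cast_natCast] at h
  rw [h]
  exact polyaVinogradov_even_int hq hχ heven _ _

end Literature.NumberTheory.Sieve.LargeSieve

end
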